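import Literature.AlgebraicGeometry.Villaflor2022.LinearCyclePeriodsIntegral
import HarnessLib

/-!
# The intersection pairing of two linear cycles of the Fermat variety in ARBITRARY position — exact value
# (Aljovin–Movasati–Villaflor 2019, §3.1 eq. (4); Villaflor, manuscripta math. 167 (2022), Cor. 2 (ii), Cor. 4;
# Movasati–Villaflor 2018, Thm. 1)

Certified instances and evidence bearing on the general Hodge conjecture; no claim.

## Sources (read from the held texts)

* E. Aljovin, H. Movasati, R. Villaflor Loyola, *Integral Hodge conjecture for Fermat varieties*, J. Symbolic
  Comput. 95 (2019) 177–184 = arXiv:1711.02628 [AljovinMovasatiVillaflor2019], §3.1 "The lattice of linear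
  algebraic cycles", eq. (4) (held text p. 5): for the linear cycles `P_i` of the Fermat variety `X^d_n`
  (`x_{b_0} − ζ_{2d}^{1+2a_1} x_{b_1} = ⋯ = x_{b_n} − ζ_{2d}^{1+2a_{n+1}} x_{b_{n+1}} = 0`, ANY pairing `b`),
  "one can use the adjunction formula and show `P_i·P_j = (1 − (−d+1)^{m+1})/d` where `dim(P_i ∩ P_j) = m`,
  see [ho13]" (Movasati, *A Course in Hodge Theory*, 2021). This is the intersection matrix `A_1 = [P_i·P_j]`
  whose elementary divisors that paper computes.
* R. Villaflor Loyola, *Periods of complete intersection algebraic cycles*, manuscripta math. 167 (2022)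
  = arXiv:1812.03964 [Villaflor2022PeriodsCI]. **Cor. 2 (ii)** (held text p. 13): for complete-intersection-type
  cycles `δ, μ` on `X = {F = 0}`, "Let `c ∈ ℂ` be the unique number such that `P_δ·P_μ ≡ c·det(Hess(F))`
  (mod `J^F`), then `δ·μ = deg(δ)deg(μ)/deg(X) − c·(deg(X)−1)^{n+2}/deg(X)`." **Cor. 4** (pp. 13–14): for the
  Fermat variety and `ℙ^{n/2}_α = {x_0 − ζ_{2d}^{α_0}x_1 = ⋯ = x_n − ζ_{2d}^{α_n}x_{n+1} = 0}`,
  `P_δ = d^{n/2+1} ζ_{2d}^{α_0+⋯+α_n} ∏_j (Σ_{l=0}^{d−2} x_{2j−2}^{d−2−l} ζ_{2d}^{α_{2j−2}l} x_{2j−1}^l)`, "In particular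
  `ℙ^{n/2}_α·ℙ^{n/2}_β = (1−(1−d)^{m+1})/d` where `m = dim ℙ^{n/2}_α ∩ ℙ^{n/2}_β`"; proof (SAME pairing only):
  `P_δ·P_μ ≡ c·d^{n+2}(d−1)^{n+2}(x_0⋯x_{n+1})^{d−2} (mod ⟨x_i^{d−1}⟩)`, "For every `j` […]
  `Σ_{l=0}^{d−2} ζ_{2d}^{α_{2j−2}(l+1)+β_{2j−2}(d−1−l)} = 1 − d` if `α_{2j−2} = β_{2j−2}`, `1` if `α_{2j−2} ≠ β_{2j−2}`.
  Therefore `c(d−1)^{n+2} = (1−d)^{m+1}`." **Remark 5**: `c·(d−1)^{n+2} ∈ ℤ`.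
* H. Movasati, R. Villaflor Loyola, *Periods of linear algebraic cycles*, Pure Appl. Math. Q. 14 (2018)
  = arXiv:1705.00084 [MovasatiVillaflor2018], **Thm. 1** (held text p. 3): the period of `ℙ^{n/2}_{a,b}` against
  the monomial form `ω_i` is `sign(b)·(−1)^{n/2}/(d^{n/2+1}(n/2)!) · ζ_{2d}^{Σ_e (i_{b_{2e}}+1)(1+2a_{2e+1})}` if
  `i_{b_{2e}} + i_{b_{2e+1}} = d − 2` for all `e`, and `0` otherwise — the ORIENTATION SIGN `sign(b)` of a pairing.

## What this file PROVES (0 facts, 0 sorry), over any field `K`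

Combining the two printed statements (AMV eq. (4) for ALL pairs of linear cycles; Villaflor Cor. 2 (ii)) gives
the algebraic identity `c·(d−1)^{n+2} = (1−d)^{m+1}` for two linear cycles in ARBITRARY mutual position, which
Villaflor's Cor. 4 proves by hand only for the same pairing. Here it is proved for all positions, purely
algebraically, in the tree's vocabulary (`HodgeTheory.fermatLinearCyclePolynomial` = `P_δ/(d^{n/2+1}ζ^{Σα})`,
`HodgeTheory.fermatLinearCycleFunctional` = the restriction-to-the-cycle socle functional `ℓ_a`, whose values on
monomials are MV18's periods, tree `MovasatiVillaflor2018.linearCycleFunctional_monomial`):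

* `prod_mul_pairing_eq` (**main theorem**): for finite types `ι`, `T`, twists `a_j^d = −1 = c_t^d`, `d ≥ 2`, and ANY
  position map `ρ : T ⊕ T ≃ ι ⊕ ι`,
  `(∏_j a_j)(∏_t c_t) · ℓ_a(P_c ∘ ρ) = sgnRel(ρ) · (1 − d)^{nullity ρ a c}`,
  where `sgnRel ρ ∈ {±1}` is the sign of `ρ` read through any bijection `T ≃ ι` (`sgnRel_eq`: independent of the
  choice; `= sign ρ` when `T = ι`) and `nullity ρ a c = dim_K ker` of the `n + 2` linear forms of the two cycles
  (`finrank_ker_jointForm`: `= dim(ℙ_a ∩ ℙ_{c,ρ}) + 1`); `prod_mul_pairing_eq_finrank`, `prod_mul_pairing_eq_sign`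
  (`T = ι`), `pairing_ne_zero` (two linear cycles are never orthogonal when `1 − d ≠ 0` in `K`).
* `linearCycleFunctional_linearCyclePolyMV` (**MV18 form**): for `ζ^d = −1` and ANY `a, a', b, b'`,
  `ℓ_{a,b}(P^{MV}_{a',b'}) = sign(b')·(1 − d)^{m+1}`, `m + 1 = dim ker(jointFormMV)` = `dim(ℙ_{a,b} ∩ ℙ_{a',b'}) + 1`,
  with the tree's `MovasatiVillaflor2018.linearCycleFunctional` (which carries MV18's `sign(b)·ζ^{Σ(1+2a)}`) and
  `Villaflor2022.linearCyclePolyMV` (Villaflor's `P_δ/c_δ`); sign-free form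
  `linearCycleFunctional_sign_smul_linearCyclePolyMV`: `ℓ_{a,b}(sign(b')·P^{MV}_{a',b'}) = (1 − d)^{m+1}` —
  the algebraic shadow of `[ℙ]_prim·[ℙ']_prim = ℙ·ℙ' − 1/d = −(1−d)^{m+1}/d`.

* `fermatSocleFunctional_mul_fermatLinearCyclePolynomial` (**socle form, `ψ = ℓ`**): for every `g`,
  `coeff_{x^{socle}}(g · P_c) = ℓ_c(g)` — the restriction functional IS Villaflor's socle pairing with `P_c`
  (Cor. 2 (ii)'s `c`, no hidden constant); hence `prod_mul_fermatSocleFunctional_mul_eq` (the main theorem as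
  `c·(d−1)^{n+2} = (1−d)^{m+1}` for the product of the two cycle polynomials) and `colon_add_eq_annIdeal_add`:
  **`(J : a₁P_{t₁} + a₂P_{t₂}) = Ann(a₁ℓ_{t₁} + a₂ℓ_{t₂})` exactly** (the tree's
  `Villaflor2022.exists_colon_add_eq_annIdeal` had an undetermined `w ≠ 0`): the Artinian Gorenstein ideal of a
  census class `r[ℙ] + ř[ℙ̌]` is the annihilator of the same combination of the two period functionals.

It refines `Villaflor2022.linearCyclePairing_integral` (lit-g19: the same number is `∈ ℤ`, value not determined)
and extends `DuqueFrancoVillaflor2023.prod_mul_fermatLinearCycleFunctional_eq` (lit-g20: the value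
`(1−d)^{#{j : a_j = c_j}}` for the SAME pairing `ρ = 1`) to arbitrary position.

## Method (an induction on the number of pairs not spelled out in print)

Remove one pair `t₀` of the second cycle; `u = ρ(t₀,0)`, `v = ρ(t₀,1)` sit in pairs `j₁, j₂` of the first cycle.
* LOOP (`j₁ = j₂`, so `v = ū`): the factor of `t₀` restricts to `pairSum(A,B)·y_j^{d−2}` with `A = wt(u)`,
  `B = c_{t₀}wt(v)`, `A^d = B^d`, and `A·B·pairSum(A,B) = −A^d·(1−d)^{[A=B]}` (`mul_mul_pairSum_eq` — Cor. 4's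
  dichotomy with its sign); the rest is the pairing of the restricted configuration (`pairing_loop`), the nullity
  drops by `[A = B]` (`nullity_eq_nullity_loopPos_add`), and `−A^d = sign` of the re-pairing (`sgnRel_loopPos`).
* MERGE (`j₁ ≠ j₂`): reading the socle coefficient after the substitution `y_{j₁} ↦ β'y, y_{j₂} ↦ α'y`
  (lit-g19's `Villaflor2022.coeff_mergeHom`) glues the pairs `j₁, j₂` into one pair with twist
  `a' = W₁/W₂` (`W₁ = c_{t₀}wt(ū)wt(v)`, `W₂ = wt(v̄)wt(u)`, `a'^d = −1`), giving again two linear cycles with one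
  pair less on each side (`pairing_merge`, position map `mergePos`); the nullity is unchanged (`nullity_mergePos`),
  and the scalar `a_{j₁}a_{j₂}c_{t₀}W₂^{d−2}/a' = W₂^d = ±1` is exactly the sign of the re-pairing permutation
  `mergePerm` (`sgnRel_mergePos`, `mergeW₂_pow`).
* The sign bookkeeping: `sgnRel` is invariant under removing a pair mapped straight onto a pair
  (`sgnRel_restrictPos`, via `Equiv.Perm.sign_subtypePerm`) and multiplicative under re-pairing (`sgnRel_trans`).

What is NOT formalised (cited only): the transcendental statements themselves — that `ℓ_a` IS the period
functional of `ℙ_a` up to the universal constant (MV18 Thm. 1 / Villaflor Cor. 5), Villaflor's Cor. 2 (ii)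
(Carlson–Griffiths), and the adjunction-formula proof of AMV eq. (4) in [ho13]; granted Cor. 2 (ii), the theorem
below IS eq. (4) for every pair of linear cycles of `X^n_d`.
-/

noncomputable section

open MvPolynomial Finset Module Literature.AlgebraicGeometry.HodgeTheory Literature.AlgebraicGeometry.Villaflor2022
  Literature.AlgebraicGeometry.Kloosterman2025 Literature.AlgebraicGeometry.DuqueFrancoVillaflor2025

namespace Literature.AlgebraicGeometry.AljovinMovasatiVillaflor2019

variable {K : Type*} [Field K]

/-! ## Slots: pair index, partner, weights -/

section Slots

variable {ι : Type*}

/-- The pair to which a slot (coordinate) belongs: `x_{2j} = inl j ↦ j`, `x_{2j+1} = inr j ↦ j`.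
[cite: MovasatiVillaflor2018, §1] -/
def idx : ι ⊕ ι → ι := Sum.elim id id

/-- `idx (inl j) = j`. [cite: MovasatiVillaflor2018, §1] -/
@[simp] theorem idx_inl (j : ι) : idx (Sum.inl j : ι ⊕ ι) = j := rfl

/-- `idx (inr j) = j`. [cite: MovasatiVillaflor2018, §1] -/
@[simp] theorem idx_inr (j : ι) : idx (Sum.inr j : ι ⊕ ι) = j := rfl

/-- The partner slot lies in the same pair. [cite: MovasatiVillaflor2018, §1] -/
@[simp] theorem idx_swap (x : ι ⊕ ι) : idx x.swap = idx x := by cases x <;> rfl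

/-- Two slots of the same pair are equal or partners. [cite: MovasatiVillaflor2018, §1] -/
theorem eq_or_eq_swap_of_idx_eq {x y : ι ⊕ ι} (h : idx x = idx y) : x = y ∨ x = y.swap := by
  rcases x with i | i <;> rcases y with j | j <;> simp only [idx_inl, idx_inr] at h <;> subst h <;> simp

/-- The slots of the pair `j` are `inl j` and `inr j`. [cite: MovasatiVillaflor2018, §1] -/
theorem idx_eq_iff {x : ι ⊕ ι} {j : ι} : idx x = j ↔ x = Sum.inl j ∨ x = Sum.inr j := by
  rcases x with i | i <;> simp

variable (a : ι → K)

/-- The weights of the restriction `x_{2j} ↦ a_j y_j`, `x_{2j+1} ↦ y_j` to the linear cycle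
`{x_{2j} = a_j x_{2j+1}}`: `a_j` on the slot `inl j`, `1` on `inr j`. [cite: Villaflorloyola2021, Proposition 5.2] -/
def wt : ι ⊕ ι → K := Sum.elim a fun _ => 1

/-- `wt a (inl j) = a j`. [cite: Villaflorloyola2021, Proposition 5.2] -/
@[simp] theorem wt_inl (j : ι) : wt a (Sum.inl j) = a j := rfl

/-- `wt a (inr j) = 1`. [cite: Villaflorloyola2021, Proposition 5.2] -/
@[simp] theorem wt_inr (j : ι) : wt a (Sum.inr j) = 1 := rfl

/-- The two weights of a pair multiply to the twist. [cite: Villaflorloyola2021, Proposition 5.2] -/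
theorem wt_mul_wt_swap (x : ι ⊕ ι) : wt a x * wt a x.swap = a (idx x) := by
  rcases x with j | j <;> simp

/-- `d`-th powers of the weights: `a_j^d = −1` on `inl`, `1` on `inr`. [cite: Villaflorloyola2021, Proposition 5.2] -/
theorem wt_pow {d : ℕ} (ha : ∀ j, a j ^ d = -1) (x : ι ⊕ ι) :
    wt a x ^ d = if x.isLeft then -1 else 1 := by
  rcases x with j | j <;> simp [ha]

/-- The weights are non-zero (`d ≥ 1`). [cite: Villaflorloyola2021, Proposition 5.2] -/
theorem wt_ne_zero {d : ℕ} (hd : 1 ≤ d) (ha : ∀ j, a j ^ d = -1) (x : ι ⊕ ι) : wt a x ≠ 0 := by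
  intro h
  have h' := wt_pow a ha x
  rw [h, zero_pow (by omega)] at h'
  split_ifs at h' <;> norm_num at h'

/-- The restriction to the cycle on a variable: `x_s ↦ wt_s · y_{idx s}`.
[cite: DuqueFrancoVillaflor2025Join, Remark 7.1] -/
theorem fermatLinearCycleSubst_X (x : ι ⊕ ι) :
    fermatLinearCycleSubst a (X x) = C (wt a x) * X (idx x) := by
  rcases x with j | j
  · rw [fermatLinearCycleSubst_X_inl, wt_inl, idx_inl]
  · rw [fermatLinearCycleSubst_X_inr, wt_inr, idx_inr, C_1, one_mul]

end Slots

/-! ## The relative sign of a position map `ρ : T ⊕ T ≃ ι ⊕ ι` -/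

section Sign

variable {ι T : Type*} [Fintype ι] [Fintype T] [DecidableEq T]

omit [DecidableEq T] in
/-- Two pairings of the same set of coordinates have the same number of pairs. [cite: MovasatiVillaflor2018, §1] -/
theorem card_eq_of_pos (ρ : T ⊕ T ≃ ι ⊕ ι) : Fintype.card T = Fintype.card ι := by
  have h := Fintype.card_congr ρ
  rw [Fintype.card_sum, Fintype.card_sum] at h
  omega

/-- **The relative sign** of the position map `ρ` (the second cycle's `t`-th pair sits at the slots
`ρ(inl t), ρ(inr t)` of the first cycle's coordinates): the sign of `ρ` read through ANY identification
`T ≃ ι` of the two index sets (independent of the choice, `sgnRel_eq`). For `T = ι` it is the sign of the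
permutation `ρ`; for MV18's cycles `ℙ_{a,b}`, `ℙ_{a',b'}` it is `sign(b)·sign(b')`.
[cite: MovasatiVillaflor2018, Theorem 1] -/
def sgnRel (ρ : T ⊕ T ≃ ι ⊕ ι) : ℤˣ :=
  Equiv.Perm.sign (ρ.trans (Equiv.sumCongr (Fintype.equivOfCardEq (card_eq_of_pos ρ))
    (Fintype.equivOfCardEq (card_eq_of_pos ρ))).symm)

/-- Independence of the reference bijection: relabelling both copies of `T` by the same bijection is an
even permutation. [cite: MovasatiVillaflor2018, Theorem 1] -/
theorem sgnRel_eq (ρ : T ⊕ T ≃ ι ⊕ ι) (φ : T ≃ ι) :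
    sgnRel ρ = Equiv.Perm.sign (ρ.trans (Equiv.sumCongr φ φ).symm) := by
  unfold sgnRel
  generalize Fintype.equivOfCardEq (card_eq_of_pos ρ) = ψ
  have h : ρ.trans (Equiv.sumCongr φ φ).symm =
      (ρ.trans (Equiv.sumCongr ψ ψ).symm).trans
        (Equiv.Perm.sumCongr (ψ.trans φ.symm) (ψ.trans φ.symm)) := by
    ext x
    simp only [Equiv.trans_apply, Equiv.sumCongr_symm, Equiv.sumCongr_apply]
    rcases ρ x with i | i <;> simp
  rw [h, Equiv.Perm.sign_trans, Equiv.Perm.sign_sumCongr, Int.units_mul_self, one_mul]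

/-- Composing with a permutation of the target slots multiplies the relative sign by its sign.
[cite: MovasatiVillaflor2018, Theorem 1] -/
theorem sgnRel_trans [DecidableEq ι] (ρ : T ⊕ T ≃ ι ⊕ ι) (τ : Equiv.Perm (ι ⊕ ι)) :
    sgnRel (ρ.trans τ) = Equiv.Perm.sign τ * sgnRel ρ := by
  obtain ⟨φ⟩ : Nonempty (T ≃ ι) := ⟨Fintype.equivOfCardEq (card_eq_of_pos ρ)⟩
  rw [sgnRel_eq _ φ, sgnRel_eq _ φ]
  have h : (ρ.trans τ).trans (Equiv.sumCongr φ φ).symm =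
      (ρ.trans (Equiv.sumCongr φ φ).symm).trans ((Equiv.sumCongr φ φ).symm.permCongr τ) := by
    ext x
    simp
  rw [h, Equiv.Perm.sign_trans, Equiv.Perm.sign_permCongr]

/-- For two pairings of the same index type the relative sign is the sign of the permutation.
[cite: MovasatiVillaflor2018, Theorem 1] -/
theorem sgnRel_eq_sign [DecidableEq ι] (ρ : Equiv.Perm (ι ⊕ ι)) : sgnRel ρ = Equiv.Perm.sign ρ := by
  rw [sgnRel_eq ρ (Equiv.refl ι)]
  congr 1
  ext x
  simp

end Sign

/-! ## Removing one pair on each side: restriction of a position map -/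

section Restrict

variable {ι T : Type*}

/-- The slots outside the pair `i` are the slots of the remaining pairs. [cite: MovasatiVillaflor2018, §1] -/
def slotsNe (i : ι) : {σ : ι ⊕ ι // idx σ ≠ i} ≃ ({j : ι // j ≠ i} ⊕ {j : ι // j ≠ i}) where
  toFun σ := match σ with
    | ⟨Sum.inl j, h⟩ => Sum.inl ⟨j, h⟩
    | ⟨Sum.inr j, h⟩ => Sum.inr ⟨j, h⟩
  invFun x := match x with
    | Sum.inl j => ⟨Sum.inl j.1, j.2⟩
    | Sum.inr j => ⟨Sum.inr j.1, j.2⟩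
  left_inv := by rintro ⟨j | j, h⟩ <;> rfl
  right_inv := by rintro (⟨j, h⟩ | ⟨j, h⟩) <;> rfl

/-- The inclusion of the slots of the remaining pairs. [cite: MovasatiVillaflor2018, §1] -/
theorem val_slotsNe_symm (i : ι) (x : {j : ι // j ≠ i} ⊕ {j : ι // j ≠ i}) :
    ((slotsNe i).symm x).1 = Sum.map Subtype.val Subtype.val x := by
  rcases x with ⟨j, h⟩ | ⟨j, h⟩ <;> rfl

/-- … and its inverse. [cite: MovasatiVillaflor2018, §1] -/
theorem map_val_slotsNe (i : ι) (σ : {σ : ι ⊕ ι // idx σ ≠ i}) :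
    Sum.map Subtype.val Subtype.val (slotsNe i σ) = σ.1 := by
  rcases σ with ⟨j | j, h⟩ <;> rfl

/-- The inclusion of the slots of the remaining pairs is injective. [cite: MovasatiVillaflor2018, §1] -/
theorem sum_map_val_injective (i : ι) :
    Function.Injective (Sum.map (Subtype.val : {j : ι // j ≠ i} → ι) (Subtype.val : {j : ι // j ≠ i} → ι)) := by
  rintro (⟨x, hx⟩ | ⟨x, hx⟩) (⟨y, hy⟩ | ⟨y, hy⟩) h <;>
    simp only [Sum.map_inl, Sum.map_inr, Sum.inl.injEq, Sum.inr.injEq, reduceCtorEq] at h <;> subst h <;> rfl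

variable (ρ : T ⊕ T ≃ ι ⊕ ι) {t₀ : T} {j₀ : ι}

/-- If `ρ` maps the pair `t₀` straight onto the pair `j₀`, it maps the other slots onto the other slots.
[cite: MovasatiVillaflor2018, §1] -/
theorem idx_ne_iff_of_straight (h1 : ρ (Sum.inl t₀) = Sum.inl j₀) (h2 : ρ (Sum.inr t₀) = Sum.inr j₀)
    (σ : T ⊕ T) : idx σ ≠ t₀ ↔ idx (ρ σ) ≠ j₀ := by
  rw [not_iff_not, idx_eq_iff, idx_eq_iff, ← h1, ← h2, ρ.injective.eq_iff, ρ.injective.eq_iff]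

/-- **Restriction of a position map** straight on `t₀ ↦ j₀` to the remaining pairs.
[cite: MovasatiVillaflor2018, §1] -/
def restrictPos (h1 : ρ (Sum.inl t₀) = Sum.inl j₀) (h2 : ρ (Sum.inr t₀) = Sum.inr j₀) :
    ({t : T // t ≠ t₀} ⊕ {t : T // t ≠ t₀}) ≃ ({j : ι // j ≠ j₀} ⊕ {j : ι // j ≠ j₀}) :=
  (slotsNe t₀).symm.trans ((ρ.subtypeEquiv (idx_ne_iff_of_straight ρ h1 h2)).trans (slotsNe j₀))

/-- The restriction is `ρ` on the remaining slots. [cite: MovasatiVillaflor2018, §1] -/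
theorem map_val_restrictPos (h1 : ρ (Sum.inl t₀) = Sum.inl j₀) (h2 : ρ (Sum.inr t₀) = Sum.inr j₀)
    (σ : {t : T // t ≠ t₀} ⊕ {t : T // t ≠ t₀}) :
    Sum.map Subtype.val Subtype.val (restrictPos ρ h1 h2 σ) = ρ (Sum.map Subtype.val Subtype.val σ) := by
  rw [restrictPos, Equiv.trans_apply, Equiv.trans_apply, map_val_slotsNe]
  change ρ ((slotsNe t₀).symm σ).1 = _
  rw [val_slotsNe_symm]

variable [Fintype ι] [Fintype T] [DecidableEq ι] [DecidableEq T]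

/-- **The relative sign is unchanged by removing a pair mapped straight onto a pair.**
[cite: MovasatiVillaflor2018, Theorem 1] -/
theorem sgnRel_restrictPos (h1 : ρ (Sum.inl t₀) = Sum.inl j₀) (h2 : ρ (Sum.inr t₀) = Sum.inr j₀) :
    sgnRel (restrictPos ρ h1 h2) = sgnRel ρ := by
  -- a reference bijection with `φ t₀ = j₀` and its restriction
  obtain ⟨φ₀⟩ : Nonempty (T ≃ ι) := ⟨Fintype.equivOfCardEq (card_eq_of_pos ρ)⟩
  set φ : T ≃ ι := φ₀.trans (Equiv.swap (φ₀ t₀) j₀) with hφdef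
  have hφ : φ t₀ = j₀ := by simp [hφdef]
  have hφ' : ∀ t : T, t ≠ t₀ ↔ φ t ≠ j₀ := fun t => by rw [ne_eq, ne_eq, ← hφ, φ.injective.eq_iff]
  set φ' : {t : T // t ≠ t₀} ≃ {j : ι // j ≠ j₀} := φ.subtypeEquiv hφ'
  -- the permutation computing `sgnRel ρ` fixes the two slots of `t₀`
  set P : Equiv.Perm (T ⊕ T) := ρ.trans (Equiv.sumCongr φ φ).symm with hPdef
  have hP1 : P (Sum.inl t₀) = Sum.inl t₀ := by
    simp only [hPdef, Equiv.trans_apply, h1, Equiv.sumCongr_symm, Equiv.sumCongr_apply, Sum.map_inl,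
      Sum.inl.injEq]
    rw [← hφ, Equiv.symm_apply_apply]
  have hP2 : P (Sum.inr t₀) = Sum.inr t₀ := by
    simp only [hPdef, Equiv.trans_apply, h2, Equiv.sumCongr_symm, Equiv.sumCongr_apply, Sum.map_inr,
      Sum.inr.injEq]
    rw [← hφ, Equiv.symm_apply_apply]
  have hidx : ∀ y : ι ⊕ ι, idx ((Equiv.sumCongr φ φ).symm y) = φ.symm (idx y) := by
    rintro (j | j) <;> rfl
  have hPp : ∀ σ : T ⊕ T, idx (P σ) ≠ t₀ ↔ idx σ ≠ t₀ := by
    intro σ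
    rw [idx_ne_iff_of_straight ρ h1 h2 σ, hPdef, Equiv.trans_apply, hidx, ne_eq, ne_eq,
      Equiv.symm_apply_eq, hφ]
  have hPfix : ∀ σ : T ⊕ T, P σ ≠ σ → idx σ ≠ t₀ := by
    intro σ hσ h
    rcases idx_eq_iff.mp h with rfl | rfl
    · exact hσ hP1
    · exact hσ hP2
  -- its restriction is, up to the identification `slotsNe`, the permutation computing `sgnRel ρ'`
  have hres : (restrictPos ρ h1 h2).trans (Equiv.sumCongr φ' φ').symm =
      (slotsNe t₀).symm.trans ((P.subtypePerm hPp).trans (slotsNe t₀)) := by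
    refine Equiv.ext fun σ => sum_map_val_injective t₀ ?_
    have lhs : ∀ x : {j : ι // j ≠ j₀} ⊕ {j : ι // j ≠ j₀},
        Sum.map Subtype.val Subtype.val ((Equiv.sumCongr φ' φ').symm x) =
          (Equiv.sumCongr φ φ).symm (Sum.map Subtype.val Subtype.val x) := by
      rintro (⟨j, hj⟩ | ⟨j, hj⟩) <;> rfl
    have e1 : Sum.map Subtype.val Subtype.val
        (((restrictPos ρ h1 h2).trans (Equiv.sumCongr φ' φ').symm) σ) = P (Sum.map Subtype.val Subtype.val σ) := by
      rw [Equiv.trans_apply, lhs, map_val_restrictPos, hPdef, Equiv.trans_apply]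
    have e2 : Sum.map Subtype.val Subtype.val
        (((slotsNe t₀).symm.trans ((P.subtypePerm hPp).trans (slotsNe t₀))) σ) =
          P (Sum.map Subtype.val Subtype.val σ) := by
      rw [Equiv.trans_apply, Equiv.trans_apply, map_val_slotsNe, Equiv.Perm.subtypePerm_apply]
      change P ((slotsNe t₀).symm σ).1 = _
      rw [val_slotsNe_symm]
    exact e1.trans e2.symm
  rw [sgnRel_eq _ φ', sgnRel_eq _ φ, hres, ← hPdef]
  rw [show (slotsNe t₀).symm.trans ((P.subtypePerm hPp).trans (slotsNe t₀)) =
      (slotsNe t₀).permCongr (P.subtypePerm hPp) from rfl, Equiv.Perm.sign_permCongr,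
    Equiv.Perm.sign_subtypePerm P hPp hPfix]

end Restrict


/-! ## The linear equations of the two cycles and the nullity `m + 1 = dim(ℙ ∩ ℙ') + 1` -/

section Nullity

variable {ι T : Type*}

/-- **The equations of the second cycle restricted to the first.** On the cone `Λ_a = {x_{2j} = a_j x_{2j+1}}`
with coordinates `y_j = x_{2j+1}` (so `x_s = wt_s·y_{idx s}`), the `t`-th equation
`x_{ρ(t,0)} = c_t x_{ρ(t,1)}` of the second cycle reads `wt_{ρ(t,0)} y_{idx ρ(t,0)} − c_t wt_{ρ(t,1)} y_{idx ρ(t,1)} = 0`.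
[cite: AljovinMovasatiVillaflor2019, §3.1, eq. (4)] -/
def posForm (ρ : T ⊕ T ≃ ι ⊕ ι) (a : ι → K) (c : T → K) : (ι → K) →ₗ[K] (T → K) where
  toFun Y t := wt a (ρ (Sum.inl t)) * Y (idx (ρ (Sum.inl t))) -
    c t * wt a (ρ (Sum.inr t)) * Y (idx (ρ (Sum.inr t)))
  map_add' Y Z := by
    ext t
    simp only [Pi.add_apply]
    ring
  map_smul' r Y := by
    ext t
    simp only [Pi.smul_apply, smul_eq_mul, RingHom.id_apply]
    ring

/-- Value of `posForm`. [cite: AljovinMovasatiVillaflor2019, §3.1, eq. (4)] -/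
theorem posForm_apply (ρ : T ⊕ T ≃ ι ⊕ ι) (a : ι → K) (c : T → K) (Y : ι → K) (t : T) :
    posForm ρ a c Y t = wt a (ρ (Sum.inl t)) * Y (idx (ρ (Sum.inl t))) -
      c t * wt a (ρ (Sum.inr t)) * Y (idx (ρ (Sum.inr t))) := rfl

/-- **The joint linear system of the two cycles** on `K^{n+2} = K^{ι ⊕ ι}`: `x_{2j} − a_j x_{2j+1}` (`j ∈ ι`) and
`x_{ρ(t,0)} − c_t x_{ρ(t,1)}` (`t ∈ T`). Its kernel is the cone over `ℙ^{n/2}_{a} ∩ ℙ^{n/2}_{c,ρ}`.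
[cite: AljovinMovasatiVillaflor2019, §3.1, eq. (4)] -/
def jointForm (ρ : T ⊕ T ≃ ι ⊕ ι) (a : ι → K) (c : T → K) : (ι ⊕ ι → K) →ₗ[K] (ι ⊕ T → K) where
  toFun x := Sum.elim (fun j => x (Sum.inl j) - a j * x (Sum.inr j))
    (fun t => x (ρ (Sum.inl t)) - c t * x (ρ (Sum.inr t)))
  map_add' x y := by
    ext (j | t)
    · simp only [Sum.elim_inl, Pi.add_apply]
      ring
    · simp only [Sum.elim_inr, Pi.add_apply]
      ring
  map_smul' r x := by
    ext (j | t)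
    · simp only [Sum.elim_inl, Pi.smul_apply, smul_eq_mul, RingHom.id_apply]
      ring
    · simp only [Sum.elim_inr, Pi.smul_apply, smul_eq_mul, RingHom.id_apply]
      ring

/-- **`m + 1`**: the dimension of the cone over `ℙ^{n/2}_a ∩ ℙ^{n/2}_{c,ρ}`, computed on `Λ_a ≅ K^{n/2+1}` as the
nullity of the restricted equations (`= dim(ℙ ∩ ℙ') + 1`, see `finrank_ker_jointForm`).
[cite: AljovinMovasatiVillaflor2019, §3.1, eq. (4)] -/
def nullity (ρ : T ⊕ T ≃ ι ⊕ ι) (a : ι → K) (c : T → K) : ℕ :=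
  finrank K (LinearMap.ker (posForm ρ a c))

/-- Transport of kernels along an injective linear map preserves the dimension. [folklore] -/
private theorem finrank_eq_of_ker_eq_map {M M' N N' : Type*} [AddCommGroup M] [Module K M] [AddCommGroup M']
    [Module K M'] [AddCommGroup N] [Module K N] [AddCommGroup N'] [Module K N']
    {L : M →ₗ[K] N} {L' : M' →ₗ[K] N'} (Φ : M' →ₗ[K] M) (hΦ : Function.Injective Φ)
    (h : LinearMap.ker L = (LinearMap.ker L').map Φ) :
    finrank K (LinearMap.ker L) = finrank K (LinearMap.ker L') := by
  rw [h]
  exact (LinearEquiv.finrank_eq (Submodule.equivMapOfInjective Φ hΦ _)).symm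

/-- The parametrisation `y ↦ (x_s = wt_s y_{idx s})` of the cone `Λ_a`. [cite: Villaflorloyola2021, Proposition 5.2] -/
def coneParam (a : ι → K) : (ι → K) →ₗ[K] (ι ⊕ ι → K) where
  toFun Y x := wt a x * Y (idx x)
  map_add' Y Z := by
    ext x
    simp only [Pi.add_apply]
    ring
  map_smul' r Y := by
    ext x
    simp only [Pi.smul_apply, smul_eq_mul, RingHom.id_apply]
    ring

/-- The parametrisation is injective (read off the `x_{2j+1}`). [cite: Villaflorloyola2021, Proposition 5.2] -/
theorem coneParam_injective (a : ι → K) : Function.Injective (coneParam (ι := ι) a) := by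
  intro Y Z h
  ext j
  have h' := congrFun h (Sum.inr j)
  simpa [coneParam] using h'

/-- **`nullity = dim(cone over ℙ ∩ ℙ')`**: the kernel of the joint system is the image of the kernel of the
restricted system under the parametrisation of `Λ_a`. [cite: AljovinMovasatiVillaflor2019, §3.1, eq. (4)] -/
theorem ker_jointForm_eq_map (ρ : T ⊕ T ≃ ι ⊕ ι) (a : ι → K) (c : T → K) :
    LinearMap.ker (jointForm ρ a c) = (LinearMap.ker (posForm ρ a c)).map (coneParam a) := by
  ext x
  rw [LinearMap.mem_ker, Submodule.mem_map]
  constructor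
  · intro hx
    have hl : ∀ j, x (Sum.inl j) = a j * x (Sum.inr j) := fun j => by
      have h := congrFun hx (Sum.inl j)
      simp only [jointForm, LinearMap.coe_mk, AddHom.coe_mk, Sum.elim_inl, Pi.zero_apply] at h
      exact sub_eq_zero.mp h
    have hr : ∀ t, x (ρ (Sum.inl t)) = c t * x (ρ (Sum.inr t)) := fun t => by
      have h := congrFun hx (Sum.inr t)
      simp only [jointForm, LinearMap.coe_mk, AddHom.coe_mk, Sum.elim_inr, Pi.zero_apply] at h
      exact sub_eq_zero.mp h
    have hpar : coneParam a (fun j => x (Sum.inr j)) = x := by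
      ext (j | j)
      · simp [coneParam, hl j]
      · simp [coneParam]
    refine ⟨fun j => x (Sum.inr j), ?_, hpar⟩
    rw [LinearMap.mem_ker]
    ext t
    have key : ∀ s : ι ⊕ ι, wt a s * x (Sum.inr (idx s)) = x s := fun s => by
      have h := congrFun hpar s
      simpa [coneParam] using h
    rw [posForm_apply, Pi.zero_apply, key, mul_assoc, key, hr t, sub_self]
  · rintro ⟨Y, hY, rfl⟩
    rw [LinearMap.mem_ker] at hY
    ext (j | t)
    · simp [jointForm, coneParam]
    · have h := congrFun hY t
      rw [posForm_apply, Pi.zero_apply] at h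
      simp only [jointForm, coneParam, LinearMap.coe_mk, AddHom.coe_mk, Sum.elim_inr, Pi.zero_apply]
      linear_combination h

/-- **`m + 1 = dim ker(joint system) = nullity`.** [cite: AljovinMovasatiVillaflor2019, §3.1, eq. (4)] -/
theorem finrank_ker_jointForm (ρ : T ⊕ T ≃ ι ⊕ ι) (a : ι → K) (c : T → K) :
    finrank K (LinearMap.ker (jointForm ρ a c)) = nullity ρ a c :=
  finrank_eq_of_ker_eq_map (coneParam a) (coneParam_injective a) (ker_jointForm_eq_map ρ a c)

/-- No pairs: nullity `0`. [folklore] -/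
private theorem nullity_of_isEmpty [IsEmpty ι] (ρ : T ⊕ T ≃ ι ⊕ ι) (a : ι → K) (c : T → K) : nullity ρ a c = 0 := by
  unfold nullity
  haveI : Subsingleton (ι → K) := inferInstance
  exact Module.finrank_zero_of_subsingleton

end Nullity


/-! ## The two elementary re-pairings of the target slots (their signs are the signs of the induction) -/

section Perms

variable {ι : Type*} [DecidableEq ι]

/-- **Merge permutation.** For slots `u, v` in different pairs `j₁ = idx u ≠ j₂ = idx v`: the permutation of
the slots with `u ↦ inl j₂`, `v ↦ inr j₂`, `ū ↦ inl j₁`, `v̄ ↦ inr j₁` (`ū, v̄` the partners) and the identity on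
all other pairs — a product of at most three transpositions. [cite: MovasatiVillaflor2018, Theorem 1] -/
def mergePerm (u v : ι ⊕ ι) : Equiv.Perm (ι ⊕ ι) :=
  ((if u.isLeft then Equiv.swap (Sum.inl (idx u)) (Sum.inr (idx u)) else 1 : Equiv.Perm (ι ⊕ ι)).trans
    (if v.isLeft then Equiv.swap (Sum.inl (idx v)) (Sum.inr (idx v)) else 1 : Equiv.Perm (ι ⊕ ι))).trans
    (Equiv.swap (Sum.inr (idx u)) (Sum.inl (idx v)))

variable {u v : ι ⊕ ι} (h : idx u ≠ idx v)
include h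

/-- `u ↦ inl j₂`. [cite: MovasatiVillaflor2018, Theorem 1] -/
theorem mergePerm_apply_fst : mergePerm u v u = Sum.inl (idx v) := by
  have h' := Ne.symm h
  rcases u with j₁ | j₁ <;> rcases v with j₂ | j₂ <;> simp only [idx_inl, idx_inr, ne_eq] at h h' <;>
    simp [mergePerm, Equiv.swap_apply_def, *]

/-- `v ↦ inr j₂`. [cite: MovasatiVillaflor2018, Theorem 1] -/
theorem mergePerm_apply_snd : mergePerm u v v = Sum.inr (idx v) := by
  have h' := Ne.symm h
  rcases u with j₁ | j₁ <;> rcases v with j₂ | j₂ <;> simp only [idx_inl, idx_inr, ne_eq] at h h' <;>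
    simp [mergePerm, Equiv.swap_apply_def, *]

/-- `ū ↦ inl j₁`. [cite: MovasatiVillaflor2018, Theorem 1] -/
theorem mergePerm_apply_fst_swap : mergePerm u v u.swap = Sum.inl (idx u) := by
  have h' := Ne.symm h
  rcases u with j₁ | j₁ <;> rcases v with j₂ | j₂ <;> simp only [idx_inl, idx_inr, ne_eq] at h h' <;>
    simp [mergePerm, Equiv.swap_apply_def, *]

/-- `v̄ ↦ inr j₁`. [cite: MovasatiVillaflor2018, Theorem 1] -/
theorem mergePerm_apply_snd_swap : mergePerm u v v.swap = Sum.inr (idx u) := by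
  have h' := Ne.symm h
  rcases u with j₁ | j₁ <;> rcases v with j₂ | j₂ <;> simp only [idx_inl, idx_inr, ne_eq] at h h' <;>
    simp [mergePerm, Equiv.swap_apply_def, *]

omit h in
/-- Identity on the other pairs. [cite: MovasatiVillaflor2018, Theorem 1] -/
theorem mergePerm_apply_of_ne {z : ι ⊕ ι} (hu : idx z ≠ idx u) (hv : idx z ≠ idx v) : mergePerm u v z = z := by
  rcases u with j₁ | j₁ <;> rcases v with j₂ | j₂ <;> rcases z with i | i <;>
    simp only [idx_inl, idx_inr, ne_eq] at hu hv <;>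
    simp [mergePerm, Equiv.swap_apply_def, hu, hv]

/-- **Sign of the merge permutation**: `(−1)^{[u is a left slot] + [v is a right slot]}`.
[cite: MovasatiVillaflor2018, Theorem 1] -/
theorem sign_mergePerm [Fintype ι] : Equiv.Perm.sign (mergePerm u v) =
    (if u.isLeft then -1 else 1) * (if v.isLeft then 1 else -1) := by
  have h' := Ne.symm h
  rcases u with j₁ | j₁ <;> rcases v with j₂ | j₂ <;> simp only [idx_inl, idx_inr, ne_eq] at h h' <;>
    simp [mergePerm, Equiv.Perm.sign_swap', *]

omit h

/-- **Loop permutation.** For a slot `u`: the identity if `u` is a left slot, else the transposition of `u`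
with its partner (so that `u ↦ inl (idx u)`, `ū ↦ inr (idx u)`). [cite: MovasatiVillaflor2018, Theorem 1] -/
def loopPerm (u : ι ⊕ ι) : Equiv.Perm (ι ⊕ ι) := if u.isLeft then 1 else Equiv.swap u u.swap

/-- `u ↦ inl (idx u)`. [cite: MovasatiVillaflor2018, Theorem 1] -/
theorem loopPerm_apply_self (u : ι ⊕ ι) : loopPerm u u = Sum.inl (idx u) := by
  rcases u with j | j <;> simp [loopPerm]

/-- `ū ↦ inr (idx u)`. [cite: MovasatiVillaflor2018, Theorem 1] -/
theorem loopPerm_apply_swap (u : ι ⊕ ι) : loopPerm u u.swap = Sum.inr (idx u) := by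
  rcases u with j | j <;> simp [loopPerm]

/-- Identity on the other pairs. [cite: MovasatiVillaflor2018, Theorem 1] -/
theorem loopPerm_apply_of_ne (u : ι ⊕ ι) {z : ι ⊕ ι} (hz : idx z ≠ idx u) : loopPerm u z = z := by
  rcases u with j | j <;> rcases z with i | i <;> simp only [idx_inl, idx_inr, ne_eq] at hz <;>
    simp [loopPerm, Equiv.swap_apply_def, hz]

/-- **Sign of the loop permutation**: `+1` for a left slot, `−1` for a right slot.
[cite: MovasatiVillaflor2018, Theorem 1] -/
theorem sign_loopPerm [Fintype ι] (u : ι ⊕ ι) : Equiv.Perm.sign (loopPerm u) = if u.isLeft then 1 else -1 := by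
  rcases u with j | j <;> simp [loopPerm, Equiv.Perm.sign_swap']

end Perms


/-! ## One step of the induction: the configurations after removing the pair `t₀` of the second cycle -/

section Step

variable {ι T : Type*}

/-- A slot of the remaining pairs, seen in `ι ⊕ ι`, equal to `inl j` is `inl ⟨j, _⟩`. [folklore] -/
private theorem eq_inl_of_map_val {j₀ j : ι} {y : {i : ι // i ≠ j₀} ⊕ {i : ι // i ≠ j₀}}
    (h : Sum.map Subtype.val Subtype.val y = Sum.inl j) (hj : j ≠ j₀) : y = Sum.inl ⟨j, hj⟩ := by
  rcases y with ⟨i, hi⟩ | ⟨i, hi⟩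
  · simp only [Sum.map_inl, Sum.inl.injEq] at h
    subst h
    rfl
  · simp at h

/-- … and equal to `inr j` is `inr ⟨j, _⟩`. [folklore] -/
private theorem eq_inr_of_map_val {j₀ j : ι} {y : {i : ι // i ≠ j₀} ⊕ {i : ι // i ≠ j₀}}
    (h : Sum.map Subtype.val Subtype.val y = Sum.inr j) (hj : j ≠ j₀) : y = Sum.inr ⟨j, hj⟩ := by
  rcases y with ⟨i, hi⟩ | ⟨i, hi⟩
  · simp at h
  · simp only [Sum.map_inr, Sum.inr.injEq] at h
    subst h
    rfl

/-- The pair index commutes with the inclusion of the remaining slots. [folklore] -/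
private theorem val_idx {j₀ : ι} (y : {i : ι // i ≠ j₀} ⊕ {i : ι // i ≠ j₀}) :
    (idx y).1 = idx (Sum.map Subtype.val Subtype.val y) := by
  rcases y with ⟨i, hi⟩ | ⟨i, hi⟩ <;> rfl

/-- Weights of a restricted twist vector. [cite: Villaflorloyola2021, Proposition 5.2] -/
theorem wt_comp_val {j₀ : ι} (a : ι → K) (y : {i : ι // i ≠ j₀} ⊕ {i : ι // i ≠ j₀}) :
    wt (fun j : {i : ι // i ≠ j₀} => a j.1) y = wt a (Sum.map Subtype.val Subtype.val y) := by
  rcases y with ⟨i, hi⟩ | ⟨i, hi⟩ <;> rfl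

/-- A slot of a remaining pair is not a slot of the removed pair. [folklore] -/
private theorem map_val_ne_inl (t₀ : T) (σ : {t : T // t ≠ t₀} ⊕ {t : T // t ≠ t₀}) :
    Sum.map Subtype.val Subtype.val σ ≠ Sum.inl t₀ := by
  rcases σ with ⟨t, ht⟩ | ⟨t, ht⟩ <;> simp [ht]

/-- … (right slot). [folklore] -/
private theorem map_val_ne_inr (t₀ : T) (σ : {t : T // t ≠ t₀} ⊕ {t : T // t ≠ t₀}) :
    Sum.map Subtype.val Subtype.val σ ≠ Sum.inr t₀ := by
  rcases σ with ⟨t, ht⟩ | ⟨t, ht⟩ <;> simp [ht]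

variable (ρ : T ⊕ T ≃ ι ⊕ ι) (a : ι → K) (c : T → K) (t₀ : T)

/-! ### Merge: the two slots of `t₀` lie in different pairs `j₁ ≠ j₂` of the first cycle -/

/-- The re-paired position map `ρ ∘ τ` (straight on `t₀ ↦ j₂`). [cite: MovasatiVillaflor2018, Theorem 1] -/
def mergeMap [DecidableEq ι] : T ⊕ T ≃ ι ⊕ ι := ρ.trans (mergePerm (ρ (Sum.inl t₀)) (ρ (Sum.inr t₀)))

variable {ρ t₀} (hne : idx (ρ (Sum.inl t₀)) ≠ idx (ρ (Sum.inr t₀)))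
include hne

/-- `ρ ∘ τ` maps `inl t₀ ↦ inl j₂`. [cite: MovasatiVillaflor2018, Theorem 1] -/
theorem mergeMap_inl [DecidableEq ι] : mergeMap ρ t₀ (Sum.inl t₀) = Sum.inl (idx (ρ (Sum.inr t₀))) := by
  rw [mergeMap, Equiv.trans_apply, mergePerm_apply_fst hne]

/-- `ρ ∘ τ` maps `inr t₀ ↦ inr j₂`. [cite: MovasatiVillaflor2018, Theorem 1] -/
theorem mergeMap_inr [DecidableEq ι] : mergeMap ρ t₀ (Sum.inr t₀) = Sum.inr (idx (ρ (Sum.inr t₀))) := by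
  rw [mergeMap, Equiv.trans_apply, mergePerm_apply_snd hne]

/-- **The merged position map** `ρ'` on the remaining pairs (`T ∖ t₀` against `ι ∖ j₂`): the two slots that
met the partners `ū, v̄` now form the pair `j₁` (`ū`-slot left, `v̄`-slot right), all other slots unchanged.
[cite: AljovinMovasatiVillaflor2019, §3.1, eq. (4)] -/
def mergePos [DecidableEq ι] : ({t : T // t ≠ t₀} ⊕ {t : T // t ≠ t₀}) ≃
    ({j : ι // j ≠ idx (ρ (Sum.inr t₀))} ⊕ {j : ι // j ≠ idx (ρ (Sum.inr t₀))}) :=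
  restrictPos (mergeMap ρ t₀) (mergeMap_inl hne) (mergeMap_inr hne)

/-- The merged position map on the remaining slots is `τ ∘ ρ`. [cite: MovasatiVillaflor2018, Theorem 1] -/
theorem map_val_mergePos [DecidableEq ι] (σ : {t : T // t ≠ t₀} ⊕ {t : T // t ≠ t₀}) :
    Sum.map Subtype.val Subtype.val (mergePos hne σ) =
      mergePerm (ρ (Sum.inl t₀)) (ρ (Sum.inr t₀)) (ρ (Sum.map Subtype.val Subtype.val σ)) := by
  rw [mergePos, map_val_restrictPos, mergeMap, Equiv.trans_apply]

/-- **Trichotomy for the remaining slots under a merge**: a remaining slot of the second cycle sits at the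
partner `ū` (and becomes the left slot of the new pair `j₁`), or at `v̄` (right slot of `j₁`), or in a pair
other than `j₁, j₂` (unchanged). [cite: AljovinMovasatiVillaflor2019, §3.1, eq. (4)] -/
theorem merge_trichotomy [DecidableEq ι] (σ : {t : T // t ≠ t₀} ⊕ {t : T // t ≠ t₀}) :
    (ρ (Sum.map Subtype.val Subtype.val σ) = (ρ (Sum.inl t₀)).swap ∧
        mergePos hne σ = Sum.inl ⟨idx (ρ (Sum.inl t₀)), hne⟩) ∨
      (ρ (Sum.map Subtype.val Subtype.val σ) = (ρ (Sum.inr t₀)).swap ∧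
        mergePos hne σ = Sum.inr ⟨idx (ρ (Sum.inl t₀)), hne⟩) ∨
      (idx (ρ (Sum.map Subtype.val Subtype.val σ)) ≠ idx (ρ (Sum.inl t₀)) ∧
        idx (ρ (Sum.map Subtype.val Subtype.val σ)) ≠ idx (ρ (Sum.inr t₀)) ∧
        Sum.map Subtype.val Subtype.val (mergePos hne σ) = ρ (Sum.map Subtype.val Subtype.val σ)) := by
  have hy := map_val_mergePos hne σ
  have hxu : ρ (Sum.map Subtype.val Subtype.val σ) ≠ ρ (Sum.inl t₀) := fun h =>
    map_val_ne_inl t₀ σ (ρ.injective h)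
  have hxv : ρ (Sum.map Subtype.val Subtype.val σ) ≠ ρ (Sum.inr t₀) := fun h =>
    map_val_ne_inr t₀ σ (ρ.injective h)
  by_cases h1 : idx (ρ (Sum.map Subtype.val Subtype.val σ)) = idx (ρ (Sum.inl t₀))
  · have hx : ρ (Sum.map Subtype.val Subtype.val σ) = (ρ (Sum.inl t₀)).swap :=
      (eq_or_eq_swap_of_idx_eq h1).resolve_left hxu
    rw [hx, mergePerm_apply_fst_swap hne] at hy
    exact Or.inl ⟨hx, eq_inl_of_map_val hy hne⟩
  · by_cases h2 : idx (ρ (Sum.map Subtype.val Subtype.val σ)) = idx (ρ (Sum.inr t₀))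
    · have hx : ρ (Sum.map Subtype.val Subtype.val σ) = (ρ (Sum.inr t₀)).swap :=
        (eq_or_eq_swap_of_idx_eq h2).resolve_left hxv
      rw [hx, mergePerm_apply_snd_swap hne] at hy
      exact Or.inr (Or.inl ⟨hx, eq_inr_of_map_val hy hne⟩)
    · rw [mergePerm_apply_of_ne h1 h2] at hy
      exact Or.inr (Or.inr ⟨h1, h2, hy⟩)

/-- **Sign of the merged position map**: `sgnRel ρ' = (−1)^{[u left] + [v right]} · sgnRel ρ`.
[cite: MovasatiVillaflor2018, Theorem 1] -/
theorem sgnRel_mergePos [Fintype ι] [Fintype T] [DecidableEq ι] [DecidableEq T] : sgnRel (mergePos hne) =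
    ((if (ρ (Sum.inl t₀)).isLeft then -1 else 1) * (if (ρ (Sum.inr t₀)).isLeft then 1 else -1)) * sgnRel ρ := by
  rw [mergePos, sgnRel_restrictPos, mergeMap, sgnRel_trans, sign_mergePerm hne]

omit hne

variable (ρ t₀)

/-- `W₁ = c_{t₀} · wt(ū) · wt(v)` — the weight of the `ū`-slot after gluing. [cite: Villaflorloyola2021, Proposition 5.1] -/
def mergeW₁ : K := c t₀ * wt a (ρ (Sum.inl t₀)).swap * wt a (ρ (Sum.inr t₀))

/-- `W₂ = wt(v̄) · wt(u)` — the weight of the `v̄`-slot after gluing (normalised to `1` in `ρ'`).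
[cite: Villaflorloyola2021, Proposition 5.1] -/
def mergeW₂ : K := wt a (ρ (Sum.inr t₀)).swap * wt a (ρ (Sum.inl t₀))

/-- **The merged twist vector** `a'`: `a'_{j₁} = W₁/W₂`, `a'_j = a_j` otherwise.
[cite: AljovinMovasatiVillaflor2019, §3.1, eq. (4)] -/
def mergeTwist [DecidableEq ι] : {j : ι // j ≠ idx (ρ (Sum.inr t₀))} → K := fun j =>
  if j.1 = idx (ρ (Sum.inl t₀)) then mergeW₁ ρ a c t₀ / mergeW₂ ρ a t₀ else a j.1

/-- `W₁ W₂ = c_{t₀} a_{j₁} a_{j₂}`. [cite: Villaflorloyola2021, Proposition 5.1] -/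
theorem mergeW₁_mul_mergeW₂ :
    mergeW₁ ρ a c t₀ * mergeW₂ ρ a t₀ = c t₀ * a (idx (ρ (Sum.inl t₀))) * a (idx (ρ (Sum.inr t₀))) := by
  rw [mergeW₁, mergeW₂, ← wt_mul_wt_swap a (ρ (Sum.inl t₀)), ← wt_mul_wt_swap a (ρ (Sum.inr t₀))]
  ring

variable {ρ a c t₀} {d : ℕ} (hd : 1 ≤ d) (ha : ∀ j, a j ^ d = -1) (hc : ∀ t, c t ^ d = -1)
include ha

/-- `W₂^d = (−1)^{[u left] + [v right]}` — the sign of the merge. [cite: MovasatiVillaflor2018, Theorem 1] -/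
theorem mergeW₂_pow : mergeW₂ ρ a t₀ ^ d =
    (if (ρ (Sum.inl t₀)).isLeft then -1 else 1) * (if (ρ (Sum.inr t₀)).isLeft then 1 else -1) := by
  rw [mergeW₂, mul_pow, wt_pow a ha, wt_pow a ha, mul_comm]
  rcases ρ (Sum.inr t₀) with j | j <;> simp

include hd in
/-- `W₂ ≠ 0`. [cite: Villaflorloyola2021, Proposition 5.1] -/
theorem mergeW₂_ne_zero : mergeW₂ ρ a t₀ ≠ 0 :=
  mul_ne_zero (wt_ne_zero a hd ha _) (wt_ne_zero a hd ha _)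

include hd hc in
/-- `W₁ ≠ 0`. [cite: Villaflorloyola2021, Proposition 5.1] -/
theorem mergeW₁_ne_zero : mergeW₁ ρ a c t₀ ≠ 0 := by
  refine mul_ne_zero (mul_ne_zero (fun h => ?_) (wt_ne_zero a hd ha _)) (wt_ne_zero a hd ha _)
  have h' := hc t₀
  rw [h, zero_pow (by omega)] at h'
  norm_num at h'

include hd hc in
/-- **The merged twists are again `d`-th roots of `−1`.** [cite: AljovinMovasatiVillaflor2019, §3.1, eq. (4)] -/
theorem mergeTwist_pow [DecidableEq ι] (j : {j : ι // j ≠ idx (ρ (Sum.inr t₀))}) :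
    mergeTwist ρ a c t₀ j ^ d = -1 := by
  unfold mergeTwist
  split_ifs with hj
  · have h2 : mergeW₂ ρ a t₀ ^ d ≠ 0 := pow_ne_zero _ (mergeW₂_ne_zero hd ha)
    have hprod : (mergeW₁ ρ a c t₀ * mergeW₂ ρ a t₀) ^ d = -1 := by
      rw [mergeW₁_mul_mergeW₂, mul_pow, mul_pow, hc, ha, ha]; ring
    have hsq : (mergeW₂ ρ a t₀ ^ d) ^ 2 = 1 := by
      rw [mergeW₂_pow ha]; split_ifs <;> norm_num
    rw [div_pow, div_eq_iff h2]
    rw [mul_pow] at hprod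
    have : mergeW₁ ρ a c t₀ ^ d * (mergeW₂ ρ a t₀ ^ d) ^ 2 = -mergeW₂ ρ a t₀ ^ d := by
      rw [pow_two, ← mul_assoc, hprod]; ring
    rw [hsq, mul_one] at this
    rw [this]; ring
  · exact ha j.1

omit ha

/-! ### Loop: the two slots of `t₀` form a pair `j` of the first cycle -/

variable (ρ t₀)

/-- The re-paired position map `ρ ∘ τ₀` (straight on `t₀ ↦ j`). [cite: MovasatiVillaflor2018, Theorem 1] -/
def loopMap [DecidableEq ι] : T ⊕ T ≃ ι ⊕ ι := ρ.trans (loopPerm (ρ (Sum.inl t₀)))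

variable {ρ t₀} (hidx : idx (ρ (Sum.inl t₀)) = idx (ρ (Sum.inr t₀)))
include hidx

/-- In a loop the second slot is the partner of the first. [cite: MovasatiVillaflor2018, §1] -/
theorem eq_swap_of_loop : ρ (Sum.inr t₀) = (ρ (Sum.inl t₀)).swap :=
  (eq_or_eq_swap_of_idx_eq hidx.symm).resolve_left fun h => Sum.inr_ne_inl (ρ.injective h)

omit hidx in
/-- `ρ ∘ τ₀` maps `inl t₀ ↦ inl j`. [cite: MovasatiVillaflor2018, Theorem 1] -/
theorem loopMap_inl [DecidableEq ι] : loopMap ρ t₀ (Sum.inl t₀) = Sum.inl (idx (ρ (Sum.inl t₀))) := by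
  rw [loopMap, Equiv.trans_apply, loopPerm_apply_self]

/-- `ρ ∘ τ₀` maps `inr t₀ ↦ inr j`. [cite: MovasatiVillaflor2018, Theorem 1] -/
theorem loopMap_inr [DecidableEq ι] : loopMap ρ t₀ (Sum.inr t₀) = Sum.inr (idx (ρ (Sum.inl t₀))) := by
  rw [loopMap, Equiv.trans_apply, eq_swap_of_loop hidx, loopPerm_apply_swap]

/-- **The position map after removing a loop.** [cite: AljovinMovasatiVillaflor2019, §3.1, eq. (4)] -/
def loopPos [DecidableEq ι] : ({t : T // t ≠ t₀} ⊕ {t : T // t ≠ t₀}) ≃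
    ({j : ι // j ≠ idx (ρ (Sum.inl t₀))} ⊕ {j : ι // j ≠ idx (ρ (Sum.inl t₀))}) :=
  restrictPos (loopMap ρ t₀) (loopMap_inl (ρ := ρ) (t₀ := t₀)) (loopMap_inr hidx)

/-- The remaining slots are untouched by removing a loop. [cite: AljovinMovasatiVillaflor2019, §3.1, eq. (4)] -/
theorem loop_dichotomy [DecidableEq ι] (σ : {t : T // t ≠ t₀} ⊕ {t : T // t ≠ t₀}) :
    idx (ρ (Sum.map Subtype.val Subtype.val σ)) ≠ idx (ρ (Sum.inl t₀)) ∧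
      Sum.map Subtype.val Subtype.val (loopPos hidx σ) = ρ (Sum.map Subtype.val Subtype.val σ) := by
  have hxu : ρ (Sum.map Subtype.val Subtype.val σ) ≠ ρ (Sum.inl t₀) := fun h =>
    map_val_ne_inl t₀ σ (ρ.injective h)
  have hxv : ρ (Sum.map Subtype.val Subtype.val σ) ≠ ρ (Sum.inr t₀) := fun h =>
    map_val_ne_inr t₀ σ (ρ.injective h)
  have h1 : idx (ρ (Sum.map Subtype.val Subtype.val σ)) ≠ idx (ρ (Sum.inl t₀)) := by
    intro h
    rcases eq_or_eq_swap_of_idx_eq h with h' | h'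
    · exact hxu h'
    · exact hxv (h'.trans (eq_swap_of_loop hidx).symm)
  refine ⟨h1, ?_⟩
  rw [loopPos, map_val_restrictPos, loopMap, Equiv.trans_apply, loopPerm_apply_of_ne _ h1]

/-- **Sign after removing a loop**: `sgnRel ρ' = (+1 if u is a left slot, −1 otherwise) · sgnRel ρ`.
[cite: MovasatiVillaflor2018, Theorem 1] -/
theorem sgnRel_loopPos [Fintype ι] [Fintype T] [DecidableEq ι] [DecidableEq T] : sgnRel (loopPos hidx) = (if (ρ (Sum.inl t₀)).isLeft then 1 else -1) * sgnRel ρ := by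
  rw [loopPos, sgnRel_restrictPos, loopMap, sgnRel_trans, sign_loopPerm]

end Step


/-! ## The period pairing of the two cycles and its behaviour under the two steps -/

section Pairing

variable {ι T : Type*} [Fintype ι] [Fintype T]

/-- **The (normalised) period of the second cycle over the first**:
`ℓ_a(P_c ∘ ρ) = coeff_{∏ y_j^{d−2}} (P_{c,ρ}(x_{2j} ↦ a_j y_j, x_{2j+1} ↦ y_j))` — the restriction of the cycle
polynomial `P_{c,ρ} = ∏_t Σ_l x_{ρ(t,0)}^l (c_t x_{ρ(t,1)})^{d−2−l}` to `Λ_a`, read against the socle; equivalently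
(`fermatSocleFunctional_mul_fermatLinearCyclePolynomial`, below) the socle coefficient of `P_a · P_{c,ρ}` modulo
`J = (x_i^{d−1})`. [cite: Villaflor2022PeriodsCI, Corollary 4] [cite: MovasatiVillaflor2018, Theorem 1] -/
def pairing (d : ℕ) (ρ : T ⊕ T ≃ ι ⊕ ι) (a : ι → K) (c : T → K) : K :=
  fermatLinearCycleFunctional a (d - 1) (rename ρ (fermatLinearCyclePolynomial c (d - 1)))

omit [Fintype ι] in
/-- The product of the factors of the remaining pairs is the cycle polynomial of the restricted twist vector,
seen in the old variables. [cite: DuqueFrancoVillaflor2025Join, Remark 7.1] -/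
theorem rename_map_val_fermatLinearCyclePolynomial [DecidableEq T] (c : T → K) (e : ℕ) (t₀ : T) :
    rename (Sum.map Subtype.val Subtype.val)
        (fermatLinearCyclePolynomial (fun t : {t : T // t ≠ t₀} => c t.1) e) =
      ∏ t ∈ univ.erase t₀, fermatLinearCycleFactor c e t := by
  rw [fermatLinearCyclePolynomial, map_prod,
    Finset.prod_subtype (univ.erase t₀) (p := fun t => t ≠ t₀) (fun t => by simp)]
  refine Finset.prod_congr rfl fun t _ => ?_
  simp only [fermatLinearCycleFactor, map_sum, map_mul, map_pow, rename_X, rename_C, Sum.map_inl, Sum.map_inr]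

omit [Fintype T] in
/-- The exponent `(d−2, …, d−2)` on the remaining pairs, seen in `ι`. [cite: Villaflor2022PeriodsCI, Corollary 4] -/
theorem mapDomain_val_fermatSocleExponent_apply [DecidableEq ι] (j₀ : ι) (e : ℕ) (j : ι) :
    Finsupp.mapDomain Subtype.val (fermatSocleExponent {i : ι // i ≠ j₀} e) j = if j = j₀ then 0 else e - 1 := by
  split_ifs with h
  · subst h
    exact Finsupp.mapDomain_notin_range _ _ (by rintro ⟨⟨i, hi⟩, h⟩; exact hi h)
  · rw [show j = (⟨j, h⟩ : {i : ι // i ≠ j₀}).1 from rfl, Finsupp.mapDomain_apply Subtype.val_injective,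
      fermatSocleExponent_apply]

variable {d : ℕ} (hd : 2 ≤ d) (ρ : T ⊕ T ≃ ι ⊕ ι) (a : ι → K) (c : T → K) (t₀ : T)

/-- Splitting off the pair `t₀`: `ℓ_a(P_c ∘ ρ) = coeff_{socle}(S_{t₀} · R)` with `S_{t₀}` the restricted factor of
`t₀` and `R` the restricted product of the other factors. [cite: Villaflor2022PeriodsCI, Corollary 4 (proof)] -/
theorem pairing_eq_coeff_mul [DecidableEq T] :
    pairing d ρ a c = coeff (fermatSocleExponent ι (d - 1))
      (fermatLinearCycleSubst a (rename ρ (fermatLinearCycleFactor c (d - 1) t₀)) *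
        fermatLinearCycleSubst a (rename ρ (∏ t ∈ univ.erase t₀, fermatLinearCycleFactor c (d - 1) t))) := by
  rw [pairing, fermatLinearCycleFunctional_apply, fermatLinearCyclePolynomial,
    ← Finset.mul_prod_erase _ _ (Finset.mem_univ t₀), map_mul, map_mul]

omit [Fintype ι] [Fintype T] in
/-- The restricted factor of the pair `t₀` as a sum of monomials
`α^l β^{d−2−l} · y_{j₁}^l y_{j₂}^{d−2−l}`, `α = wt(u)`, `β = c_{t₀} wt(v)`. [cite: Villaflorloyola2021, Proposition 5.2] -/
theorem subst_rename_factor_eq_sum :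
    fermatLinearCycleSubst a (rename ρ (fermatLinearCycleFactor c (d - 1) t₀)) =
      ∑ l ∈ range (d - 1), monomial (Finsupp.single (idx (ρ (Sum.inl t₀))) l +
        Finsupp.single (idx (ρ (Sum.inr t₀))) (d - 1 - 1 - l))
        (wt a (ρ (Sum.inl t₀)) ^ l * (c t₀ * wt a (ρ (Sum.inr t₀))) ^ (d - 1 - 1 - l)) := by
  rw [← slotSubst_std, slotSubst_fermatLinearCycleFactor_eq_sum_monomial]
  rfl

/-! ### Merge -/

variable {ρ t₀} (hne : idx (ρ (Sum.inl t₀)) ≠ idx (ρ (Sum.inr t₀)))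
  (ha : ∀ j, a j ^ d = -1) (hc : ∀ t, c t ^ d = -1)

omit [Fintype ι] [Fintype T] in
include hne in
/-- The weights of the merged twist vector, seen on the old slots: `W₁/W₂` on `inl j₁`, the old weights elsewhere.
[cite: AljovinMovasatiVillaflor2019, §3.1, eq. (4)] -/
theorem wt_mergeTwist [DecidableEq ι]
    (y : {j : ι // j ≠ idx (ρ (Sum.inr t₀))} ⊕ {j : ι // j ≠ idx (ρ (Sum.inr t₀))}) :
    wt (mergeTwist ρ a c t₀) y =
      if Sum.map Subtype.val Subtype.val y = Sum.inl (idx (ρ (Sum.inl t₀))) then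
        mergeW₁ ρ a c t₀ / mergeW₂ ρ a t₀ else wt a (Sum.map Subtype.val Subtype.val y) := by
  have _ := hne
  rcases y with ⟨i, hi⟩ | ⟨i, hi⟩
  · simp [wt, mergeTwist]
  · simp [wt]

omit [Fintype ι] [Fintype T] in
include hd ha hne in
/-- **Gluing on the variables.** The merge substitution `y_{j₁} ↦ β' y_{j₁}`, `y_{j₂} ↦ α' y_{j₁}`
(`α' = wt(u)/W₂`, `β' = c_{t₀}wt(v)/W₂`) after the restriction to `Λ_a` agrees, on the slots of the remaining
pairs, with the restriction to the merged cycle `Λ_{a'}` seen through `ρ'`.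
[cite: Villaflorloyola2021, Proposition 5.1] [cite: AljovinMovasatiVillaflor2019, §3.1, eq. (4)] -/
theorem mergeHom_comp_subst_eq [DecidableEq ι] :
    (mergeHom (idx (ρ (Sum.inl t₀))) (idx (ρ (Sum.inr t₀))) (wt a (ρ (Sum.inl t₀)) / mergeW₂ ρ a t₀)
        (c t₀ * wt a (ρ (Sum.inr t₀)) / mergeW₂ ρ a t₀)).comp
      ((fermatLinearCycleSubst a).comp
        ((rename ρ).comp (rename (Sum.map Subtype.val Subtype.val) :
          MvPolynomial ({t : T // t ≠ t₀} ⊕ {t : T // t ≠ t₀}) K →ₐ[K] MvPolynomial (T ⊕ T) K))) =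
      (rename Subtype.val).comp ((fermatLinearCycleSubst (mergeTwist ρ a c t₀)).comp (rename (mergePos hne))) := by
  have hW₂ : mergeW₂ ρ a t₀ ≠ 0 := mergeW₂_ne_zero (by omega) ha
  refine MvPolynomial.algHom_ext fun σ => ?_
  simp only [AlgHom.comp_apply, rename_X, fermatLinearCycleSubst_X, map_mul, rename_C]
  rw [mergeHom, aeval_C, aeval_X, MvPolynomial.algebraMap_eq, wt_mergeTwist a c hne, val_idx]
  rcases merge_trichotomy hne σ with ⟨hx, hy⟩ | ⟨hx, hy⟩ | ⟨h1, h2, hy⟩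
  · rw [hx, hy, idx_swap, if_pos rfl, Sum.map_inl, if_pos rfl, idx_inl, Subtype.coe_mk, ← mul_assoc, ← C_mul]
    congr 2
    rw [mergeW₁]
    ring
  · have h1 : wt a (ρ (Sum.inr t₀)).swap * (wt a (ρ (Sum.inl t₀)) / mergeW₂ ρ a t₀) = 1 := by
      rw [← mul_div_assoc, show wt a (ρ (Sum.inr t₀)).swap * wt a (ρ (Sum.inl t₀)) = mergeW₂ ρ a t₀ from rfl,
        div_self hW₂]
    rw [hx, hy, idx_swap, if_neg (Ne.symm hne), if_pos rfl, Sum.map_inr, if_neg Sum.inr_ne_inl, idx_inr,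
      wt_inr, Subtype.coe_mk, ← mul_assoc, ← C_mul, h1]
  · have hx1 : ρ (Sum.map Subtype.val Subtype.val σ) ≠ Sum.inl (idx (ρ (Sum.inl t₀))) := fun h =>
      h1 (by rw [h, idx_inl])
    rw [if_neg h1, if_neg h2, hy, if_neg hx1]

include hd ha hc hne in
/-- **The merge step for the pairing**: `ℓ_a(P_c ∘ ρ) = W₂^{d−2} · ℓ_{a'}(P_{c'} ∘ ρ')`.
[cite: AljovinMovasatiVillaflor2019, §3.1, eq. (4)] [cite: Villaflorloyola2021, Proposition 5.1] -/
theorem pairing_merge [DecidableEq ι] [DecidableEq T] :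
    pairing d ρ a c = mergeW₂ ρ a t₀ ^ (d - 2) *
      pairing d (mergePos hne) (mergeTwist ρ a c t₀) (fun t : {t : T // t ≠ t₀} => c t.1) := by
  have hW₂ : mergeW₂ ρ a t₀ ≠ 0 := mergeW₂_ne_zero (by omega) ha
  have _ := hc
  -- notation
  set j₁ := idx (ρ (Sum.inl t₀)) with hj₁
  set j₂ := idx (ρ (Sum.inr t₀)) with hj₂
  set α := wt a (ρ (Sum.inl t₀)) with hα
  set β := c t₀ * wt a (ρ (Sum.inr t₀)) with hβ
  set W₂ := mergeW₂ ρ a t₀ with hW₂def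
  set R := fermatLinearCycleSubst a (rename ρ (∏ t ∈ univ.erase t₀, fermatLinearCycleFactor c (d - 1) t))
    with hR
  set m : ι →₀ ℕ := Finsupp.mapDomain Subtype.val (fermatSocleExponent {i : ι // i ≠ j₂} (d - 1)) with hm
  have hE : d - 1 - 1 = d - 2 := by omega
  have hmj : ∀ j, m j = if j = j₂ then 0 else d - 2 := fun j => by
    rw [hm, mapDomain_val_fermatSocleExponent_apply, hE]
  -- Steps 1–3: split off and expand the factor of `t₀`
  rw [pairing_eq_coeff_mul ρ a c t₀, subst_rename_factor_eq_sum, Finset.sum_mul, coeff_sum]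
  simp_rw [coeff_monomial_mul']
  have hle : ∀ l ∈ range (d - 1), Finsupp.single j₁ l + Finsupp.single j₂ (d - 1 - 1 - l) ≤
      fermatSocleExponent ι (d - 1) := by
    intro l hl
    rw [Finset.mem_range] at hl
    intro i
    rw [Finsupp.add_apply, Finsupp.single_apply, Finsupp.single_apply, fermatSocleExponent_apply]
    split_ifs with h1 h2 <;> omega
  rw [Finset.sum_congr rfl fun l hl => if_pos (hle l hl)]
  -- Step 4: the coefficient indices are the glued exponents
  have hidx : ∀ l ∈ range (d - 1), fermatSocleExponent ι (d - 1) -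
      (Finsupp.single j₁ l + Finsupp.single j₂ (d - 1 - 1 - l)) = (m.update j₁ (m j₁ - l)).update j₂ l := by
    intro l hl
    rw [Finset.mem_range] at hl
    ext i
    simp only [Finsupp.coe_tsub, Pi.sub_apply, Finsupp.add_apply, Finsupp.single_apply,
      fermatSocleExponent_apply, Finsupp.update_apply, hmj]
    rcases eq_or_ne i j₂ with rfl | hi2
    · simp [hne]
      omega
    · rcases eq_or_ne i j₁ with rfl | hi1
      · simp [hne, Ne.symm hne]
        omega
      · simp [hi1, hi2, Ne.symm hi1, Ne.symm hi2]
        omega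
  rw [Finset.sum_congr rfl fun l hl => by rw [hidx l hl]]
  -- Step 5: this is `W₂^{d−2} · coeff_m (mergeHom j₁ j₂ α' β' R)`
  have hmerge := coeff_mergeHom hne (α / W₂) (β / W₂) R m (by rw [hmj, if_pos rfl])
  have hmj₁ : m j₁ = d - 2 := by rw [hmj, if_neg hne]
  rw [hmj₁, show d - 2 + 1 = d - 1 by omega] at hmerge
  have hsum : ∑ l ∈ range (d - 1), α ^ l * β ^ (d - 1 - 1 - l) *
      coeff ((m.update j₁ (m j₁ - l)).update j₂ l) R =
      W₂ ^ (d - 2) * coeff m (mergeHom j₁ j₂ (α / W₂) (β / W₂) R) := by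
    rw [hmerge, Finset.mul_sum]
    refine Finset.sum_congr rfl fun l hl => ?_
    rw [Finset.mem_range] at hl
    rw [hmj₁, hE, div_pow, div_pow, ← mul_assoc]
    congr 1
    field_simp
    rw [mul_assoc, ← pow_add, show l + (d - 2 - l) = d - 2 by omega]
  rw [hsum]
  -- Step 6: the glued polynomial is the restriction to the merged cycle
  have hglue : mergeHom j₁ j₂ (α / W₂) (β / W₂) R = rename Subtype.val
      (fermatLinearCycleSubst (mergeTwist ρ a c t₀)
        (rename (mergePos hne) (fermatLinearCyclePolynomial (fun t : {t : T // t ≠ t₀} => c t.1) (d - 1)))) := by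
    have h := congrArg (fun f => f (fermatLinearCyclePolynomial (fun t : {t : T // t ≠ t₀} => c t.1) (d - 1)))
      (mergeHom_comp_subst_eq hd a c hne ha)
    simp only [AlgHom.comp_apply, rename_map_val_fermatLinearCyclePolynomial] at h
    rw [← hR] at h
    exact h
  -- Step 7: read the coefficient in the new variables
  rw [hglue, hm, coeff_rename_mapDomain _ Subtype.val_injective, pairing, fermatLinearCycleFunctional_apply]

/-! ### Loop -/

variable {a c} (hidx : idx (ρ (Sum.inl t₀)) = idx (ρ (Sum.inr t₀)))

omit [Fintype ι] [Fintype T] in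
include hidx in
/-- **Restriction after removing a loop**: on the slots of the remaining pairs, restricting to `Λ_a` through `ρ`
is restricting to `Λ_{a|ι'}` through `ρ'`. [cite: AljovinMovasatiVillaflor2019, §3.1, eq. (4)] -/
theorem subst_comp_rename_eq_loop [DecidableEq ι] :
    (fermatLinearCycleSubst a).comp
        ((rename ρ).comp (rename (Sum.map Subtype.val Subtype.val) :
          MvPolynomial ({t : T // t ≠ t₀} ⊕ {t : T // t ≠ t₀}) K →ₐ[K] MvPolynomial (T ⊕ T) K)) =
      (rename Subtype.val).comp ((fermatLinearCycleSubst fun j : {j : ι // j ≠ idx (ρ (Sum.inl t₀))} => a j.1).comp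
        (rename (loopPos hidx))) := by
  refine MvPolynomial.algHom_ext fun σ => ?_
  simp only [AlgHom.comp_apply, rename_X, fermatLinearCycleSubst_X, map_mul, rename_C, wt_comp_val, val_idx]
  rw [(loop_dichotomy hidx σ).2]

include hd hidx in
/-- **The loop step for the pairing**: `ℓ_a(P_c ∘ ρ) = pairSum(wt u, c_{t₀} wt v) · ℓ_{a|ι'}(P_{c'} ∘ ρ')`.
[cite: Villaflor2022PeriodsCI, Corollary 4 (proof)] [cite: AljovinMovasatiVillaflor2019, §3.1, eq. (4)] -/
theorem pairing_loop [DecidableEq ι] [DecidableEq T] :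
    pairing d ρ a c = pairSum (d - 1) (wt a (ρ (Sum.inl t₀))) (c t₀ * wt a (ρ (Sum.inr t₀))) *
      pairing d (loopPos hidx) (fun j : {j : ι // j ≠ idx (ρ (Sum.inl t₀))} => a j.1)
        (fun t : {t : T // t ≠ t₀} => c t.1) := by
  set j₁ := idx (ρ (Sum.inl t₀)) with hj₁
  have hS : fermatLinearCycleSubst a (rename ρ (fermatLinearCycleFactor c (d - 1) t₀)) =
      C (pairSum (d - 1) (wt a (ρ (Sum.inl t₀))) (c t₀ * wt a (ρ (Sum.inr t₀)))) * X j₁ ^ (d - 2) := by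
    rw [← slotSubst_std, slotSubst_fermatLinearCycleFactor_loop d hd _ _ c t₀ hidx]
    rfl
  have hsingle : Finsupp.single j₁ (d - 2) ≤ fermatSocleExponent ι (d - 1) := fun i => by
    rw [Finsupp.single_apply, fermatSocleExponent_apply]
    split_ifs <;> omega
  rw [pairing_eq_coeff_mul ρ a c t₀, hS, mul_assoc, coeff_C_mul, X_pow_eq_monomial, coeff_monomial_mul',
    if_pos hsingle, one_mul]
  congr 1
  have hexp : fermatSocleExponent ι (d - 1) - Finsupp.single j₁ (d - 2) =
      Finsupp.mapDomain Subtype.val (fermatSocleExponent {i : ι // i ≠ j₁} (d - 1)) := by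
    ext i
    rw [Finsupp.coe_tsub, Pi.sub_apply, Finsupp.single_apply, fermatSocleExponent_apply,
      mapDomain_val_fermatSocleExponent_apply]
    rcases eq_or_ne i j₁ with rfl | hi
    · rw [if_pos rfl, if_pos rfl]
      omega
    · simp [hi, Ne.symm hi]
  have hglue : fermatLinearCycleSubst a (rename ρ (∏ t ∈ univ.erase t₀, fermatLinearCycleFactor c (d - 1) t)) =
      rename Subtype.val (fermatLinearCycleSubst (fun j : {j : ι // j ≠ j₁} => a j.1)
        (rename (loopPos hidx) (fermatLinearCyclePolynomial (fun t : {t : T // t ≠ t₀} => c t.1) (d - 1)))) := by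
    have h := congrArg (fun f => f (fermatLinearCyclePolynomial (fun t : {t : T // t ≠ t₀} => c t.1) (d - 1)))
      (subst_comp_rename_eq_loop (a := a) hidx)
    simp only [AlgHom.comp_apply, rename_map_val_fermatLinearCyclePolynomial] at h
    exact h
  rw [hexp, hglue, coeff_rename_mapDomain _ Subtype.val_injective, pairing, fermatLinearCycleFunctional_apply]

end Pairing


/-! ## The nullity under the two steps -/

section NullitySteps

variable {ι T : Type*}
variable {d : ℕ} (hd : 1 ≤ d) (ρ : T ⊕ T ≃ ι ⊕ ι) (a : ι → K) (c : T → K) (t₀ : T)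

/-! ### Merge: the nullity is unchanged -/

/-- The comparison map `Z ↦ Y` of the merge: `Y_{j₁} = β' Z_{j₁}`, `Y_{j₂} = α' Z_{j₁}`, `Y_i = Z_i` otherwise
(the solutions of the `t₀`-th equation `α Y_{j₁} = β Y_{j₂}`, parametrised by the glued variable).
[cite: AljovinMovasatiVillaflor2019, §3.1, eq. (4)] -/
def mergeLift [DecidableEq ι] {j₁ j₂ : ι} (hne : j₁ ≠ j₂) (α' β' : K) : ({j : ι // j ≠ j₂} → K) →ₗ[K] (ι → K) where
  toFun Z i := if h : i = j₂ then α' * Z ⟨j₁, hne⟩ else if i = j₁ then β' * Z ⟨j₁, hne⟩ else Z ⟨i, h⟩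
  map_add' Z Z' := by
    ext i
    simp only [Pi.add_apply]
    split_ifs <;> ring
  map_smul' r Z := by
    ext i
    simp only [Pi.smul_apply, smul_eq_mul, RingHom.id_apply]
    split_ifs <;> ring

/-- Value of `mergeLift`. [cite: AljovinMovasatiVillaflor2019, §3.1, eq. (4)] -/
theorem mergeLift_apply [DecidableEq ι] {j₁ j₂ : ι} (hne : j₁ ≠ j₂) (α' β' : K) (Z : {j : ι // j ≠ j₂} → K)
    (i : ι) : mergeLift hne α' β' Z i =
      if h : i = j₂ then α' * Z ⟨j₁, hne⟩ else if i = j₁ then β' * Z ⟨j₁, hne⟩ else Z ⟨i, h⟩ := rfl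

variable {ρ t₀} (hne : idx (ρ (Sum.inl t₀)) ≠ idx (ρ (Sum.inr t₀)))
  (ha : ∀ j, a j ^ d = -1) (hc : ∀ t, c t ^ d = -1)

include hd ha hne in
/-- The slot terms of the restricted equations match under the comparison map.
[cite: AljovinMovasatiVillaflor2019, §3.1, eq. (4)] -/
theorem wt_mul_mergeLift [DecidableEq ι] (Z : {j : ι // j ≠ idx (ρ (Sum.inr t₀))} → K)
    (σ : {t : T // t ≠ t₀} ⊕ {t : T // t ≠ t₀}) :
    wt a (ρ (Sum.map Subtype.val Subtype.val σ)) *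
        mergeLift hne (wt a (ρ (Sum.inl t₀)) / mergeW₂ ρ a t₀) (c t₀ * wt a (ρ (Sum.inr t₀)) / mergeW₂ ρ a t₀) Z
          (idx (ρ (Sum.map Subtype.val Subtype.val σ))) =
      wt (mergeTwist ρ a c t₀) (mergePos hne σ) * Z (idx (mergePos hne σ)) := by
  have hW₂ : mergeW₂ ρ a t₀ ≠ 0 := mergeW₂_ne_zero hd ha
  rw [wt_mergeTwist a c hne, mergeLift_apply]
  rcases merge_trichotomy hne σ with ⟨hx, hy⟩ | ⟨hx, hy⟩ | ⟨h1, h2, hy⟩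
  · rw [hx, hy, idx_swap, dif_neg hne, if_pos rfl, Sum.map_inl, if_pos rfl, idx_inl, ← mul_assoc]
    congr 1
    rw [mergeW₁]
    ring
  · have h1 : wt a (ρ (Sum.inr t₀)).swap * (wt a (ρ (Sum.inl t₀)) / mergeW₂ ρ a t₀) = 1 := by
      rw [← mul_div_assoc, show wt a (ρ (Sum.inr t₀)).swap * wt a (ρ (Sum.inl t₀)) = mergeW₂ ρ a t₀ from rfl,
        div_self hW₂]
    rw [hx, hy, idx_swap, dif_pos rfl, Sum.map_inr, if_neg Sum.inr_ne_inl, idx_inr, wt_inr, ← mul_assoc, h1]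
  · have hx1 : ρ (Sum.map Subtype.val Subtype.val σ) ≠ Sum.inl (idx (ρ (Sum.inl t₀))) := fun h =>
      h1 (by rw [h, idx_inl])
    have hidx' : idx (mergePos hne σ) = ⟨idx (ρ (Sum.map Subtype.val Subtype.val σ)), h2⟩ :=
      Subtype.ext (by rw [val_idx, hy])
    rw [dif_neg h2, if_neg h1, hidx', hy, if_neg hx1]

include hd ha hc hne in
/-- **The merge does not change the nullity** (`dim ℙ ∩ ℙ'` is read on the glued configuration).
[cite: AljovinMovasatiVillaflor2019, §3.1, eq. (4)] -/
theorem nullity_mergePos [DecidableEq ι] :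
    nullity (mergePos hne) (mergeTwist ρ a c t₀) (fun t : {t : T // t ≠ t₀} => c t.1) = nullity ρ a c := by
  have hW₂ : mergeW₂ ρ a t₀ ≠ 0 := mergeW₂_ne_zero hd ha
  have hc0 : c t₀ ≠ 0 := fun h => by
    have h' := hc t₀; rw [h, zero_pow (by omega)] at h'; norm_num at h'
  set α' := wt a (ρ (Sum.inl t₀)) / mergeW₂ ρ a t₀ with hα'
  set β' := c t₀ * wt a (ρ (Sum.inr t₀)) / mergeW₂ ρ a t₀ with hβ'
  have hβ0 : β' ≠ 0 := div_ne_zero (mul_ne_zero hc0 (wt_ne_zero a hd ha _)) hW₂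
  set Φ := mergeLift hne α' β' with hΦ
  -- the equations after the lift
  have hL0 : ∀ Z, posForm ρ a c (Φ Z) t₀ = 0 := fun Z => by
    rw [posForm_apply, hΦ, mergeLift_apply, mergeLift_apply, dif_neg hne, if_pos rfl, dif_pos rfl, hα', hβ']
    ring
  have hLt : ∀ Z (t : {t : T // t ≠ t₀}), posForm ρ a c (Φ Z) t.1 =
      posForm (mergePos hne) (mergeTwist ρ a c t₀) (fun t : {t : T // t ≠ t₀} => c t.1) Z t := fun Z t => by
    rw [posForm_apply, posForm_apply,
      show (Sum.inl t.1 : T ⊕ T) = Sum.map Subtype.val Subtype.val (Sum.inl t) from rfl,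
      show (Sum.inr t.1 : T ⊕ T) = Sum.map Subtype.val Subtype.val (Sum.inr t) from rfl,
      hΦ, wt_mul_mergeLift hd a c hne ha, mul_assoc, wt_mul_mergeLift hd a c hne ha, ← mul_assoc]
  symm
  refine finrank_eq_of_ker_eq_map Φ (fun Z Z' h => ?_) ?_
  · -- injectivity
    ext ⟨i, hi⟩
    by_cases hi1 : i = idx (ρ (Sum.inl t₀))
    · subst hi1
      have h1 := congrFun h (idx (ρ (Sum.inl t₀)))
      rw [hΦ, mergeLift_apply, mergeLift_apply, dif_neg hne, if_pos rfl, dif_neg hne, if_pos rfl] at h1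
      exact mul_left_cancel₀ hβ0 h1
    · have h1 := congrFun h i
      rwa [hΦ, mergeLift_apply, mergeLift_apply, dif_neg hi, if_neg hi1, dif_neg hi, if_neg hi1] at h1
  · ext Y
    rw [LinearMap.mem_ker, Submodule.mem_map]
    constructor
    · intro hY
      set Z : {j : ι // j ≠ idx (ρ (Sum.inr t₀))} → K := fun j =>
        if j.1 = idx (ρ (Sum.inl t₀)) then Y (idx (ρ (Sum.inl t₀))) / β' else Y j.1 with hZ
      have hΦZ : Φ Z = Y := by
        ext i
        rw [hΦ, mergeLift_apply]
        by_cases hi2 : i = idx (ρ (Sum.inr t₀))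
        · rw [dif_pos hi2, hZ]
          simp only [if_true]
          have h0 := congrFun hY t₀
          rw [posForm_apply, Pi.zero_apply] at h0
          have hu0 : wt a (ρ (Sum.inl t₀)) ≠ 0 := wt_ne_zero a hd ha _
          have hv0 : wt a (ρ (Sum.inr t₀)) ≠ 0 := wt_ne_zero a hd ha _
          rw [hi2, hα', hβ']
          field_simp
          linear_combination h0
        · rw [dif_neg hi2]
          by_cases hi1 : i = idx (ρ (Sum.inl t₀))
          · rw [if_pos hi1, hZ]
            simp only [if_true]
            rw [hi1, mul_div_cancel₀ _ hβ0]
          · rw [if_neg hi1, hZ]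
            simp only [hi1, if_false]
      refine ⟨Z, ?_, hΦZ⟩
      rw [LinearMap.mem_ker]
      ext t
      rw [← hLt, hΦZ, Pi.zero_apply]
      exact congrFun hY t.1
    · rintro ⟨Z, hZ, rfl⟩
      rw [LinearMap.mem_ker] at hZ
      ext t
      by_cases ht : t = t₀
      · rw [ht, hL0, Pi.zero_apply]
      · rw [Pi.zero_apply, show t = (⟨t, ht⟩ : {t : T // t ≠ t₀}).1 from rfl, hLt, hZ, Pi.zero_apply]

/-! ### Loop: the nullity drops by one exactly when the loop equation is trivial on `Λ_a` -/

omit hne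

/-- Extension by zero at the removed pair `j`. [cite: AljovinMovasatiVillaflor2019, §3.1, eq. (4)] -/
def extendZero [DecidableEq ι] (j : ι) : ({i : ι // i ≠ j} → K) →ₗ[K] (ι → K) where
  toFun Z i := if h : i = j then 0 else Z ⟨i, h⟩
  map_add' Z Z' := by
    ext i
    simp only [Pi.add_apply]
    split_ifs <;> ring
  map_smul' r Z := by
    ext i
    simp only [Pi.smul_apply, smul_eq_mul, RingHom.id_apply]
    split_ifs <;> ring

/-- Value of `extendZero`. [cite: AljovinMovasatiVillaflor2019, §3.1, eq. (4)] -/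
theorem extendZero_apply [DecidableEq ι] (j : ι) (Z : {i : ι // i ≠ j} → K) (i : ι) :
    extendZero j Z i = if h : i = j then 0 else Z ⟨i, h⟩ := rfl

/-- The coordinate vector of the removed pair. [cite: AljovinMovasatiVillaflor2019, §3.1, eq. (4)] -/
def coordVec [DecidableEq ι] (j : ι) : K →ₗ[K] (ι → K) where
  toFun x i := if i = j then x else 0
  map_add' x y := by
    ext i
    simp only [Pi.add_apply]
    split_ifs <;> ring
  map_smul' r x := by
    ext i
    simp only [Pi.smul_apply, smul_eq_mul, RingHom.id_apply]
    split_ifs <;> ring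

/-- Value of `coordVec`. [cite: AljovinMovasatiVillaflor2019, §3.1, eq. (4)] -/
theorem coordVec_apply [DecidableEq ι] (j : ι) (x : K) (i : ι) : coordVec j x i = if i = j then x else 0 := rfl

variable (hidx : idx (ρ (Sum.inl t₀)) = idx (ρ (Sum.inr t₀)))

include hidx in
/-- The equations after removing a loop: the `t₀`-th one is `(wt u − c_{t₀} wt v)·y_j`, the others are those of
the restricted configuration. [cite: AljovinMovasatiVillaflor2019, §3.1, eq. (4)] -/
theorem posForm_extendZero_add [DecidableEq ι] (Z : {i : ι // i ≠ idx (ρ (Sum.inl t₀))} → K) (x : K) :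
    posForm ρ a c (extendZero (idx (ρ (Sum.inl t₀))) Z + coordVec (idx (ρ (Sum.inl t₀))) x) t₀ =
        (wt a (ρ (Sum.inl t₀)) - c t₀ * wt a (ρ (Sum.inr t₀))) * x ∧
      ∀ t : {t : T // t ≠ t₀}, posForm ρ a c (extendZero (idx (ρ (Sum.inl t₀))) Z +
          coordVec (idx (ρ (Sum.inl t₀))) x) t.1 =
        posForm (loopPos hidx) (fun j : {j : ι // j ≠ idx (ρ (Sum.inl t₀))} => a j.1)
          (fun t : {t : T // t ≠ t₀} => c t.1) Z t := by
  constructor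
  · rw [posForm_apply, Pi.add_apply, Pi.add_apply, extendZero_apply, coordVec_apply, extendZero_apply,
      coordVec_apply, ← hidx, dif_pos rfl, if_pos rfl]
    ring
  · intro t
    have key : ∀ σ : {t : T // t ≠ t₀} ⊕ {t : T // t ≠ t₀},
        wt a (ρ (Sum.map Subtype.val Subtype.val σ)) *
          (extendZero (idx (ρ (Sum.inl t₀))) Z + coordVec (idx (ρ (Sum.inl t₀))) x)
            (idx (ρ (Sum.map Subtype.val Subtype.val σ))) =
        wt (fun j : {j : ι // j ≠ idx (ρ (Sum.inl t₀))} => a j.1) (loopPos hidx σ) * Z (idx (loopPos hidx σ)) := by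
      intro σ
      obtain ⟨h1, hy⟩ := loop_dichotomy hidx σ
      have hidx' : idx (loopPos hidx σ) = ⟨idx (ρ (Sum.map Subtype.val Subtype.val σ)), h1⟩ :=
        Subtype.ext (by rw [val_idx, hy])
      rw [Pi.add_apply, extendZero_apply, coordVec_apply, dif_neg h1, if_neg h1, add_zero, wt_comp_val, hy, hidx']
    rw [posForm_apply, posForm_apply,
      show (Sum.inl t.1 : T ⊕ T) = Sum.map Subtype.val Subtype.val (Sum.inl t) from rfl,
      show (Sum.inr t.1 : T ⊕ T) = Sum.map Subtype.val Subtype.val (Sum.inr t) from rfl,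
      key, mul_assoc, key, ← mul_assoc]

include hidx in
/-- **Removing a loop lowers the nullity by `[wt u = c_{t₀} wt v]`**, i.e. by one exactly when the hyperplane
`x_u = c_{t₀} x_v` of the second cycle contains `Λ_a ∩ {`coordinates of the other pairs`}`-direction `y_j`.
[cite: AljovinMovasatiVillaflor2019, §3.1, eq. (4)] -/
theorem nullity_eq_nullity_loopPos_add [Fintype ι] [DecidableEq ι] [DecidableEq K] :
    nullity ρ a c = nullity (loopPos hidx) (fun j : {j : ι // j ≠ idx (ρ (Sum.inl t₀))} => a j.1)
        (fun t : {t : T // t ≠ t₀} => c t.1) +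
      if wt a (ρ (Sum.inl t₀)) = c t₀ * wt a (ρ (Sum.inr t₀)) then 1 else 0 := by
  set j := idx (ρ (Sum.inl t₀)) with hj
  set κ₀ := wt a (ρ (Sum.inl t₀)) - c t₀ * wt a (ρ (Sum.inr t₀)) with hκ₀
  set L' := posForm (loopPos hidx) (fun j' : {j' : ι // j' ≠ j} => a j'.1) (fun t : {t : T // t ≠ t₀} => c t.1)
    with hL'
  set S : Submodule K K := LinearMap.ker (κ₀ • (LinearMap.id : K →ₗ[K] K)) with hS
  set p : Submodule K (ι → K) := (LinearMap.ker L').map (extendZero j) with hp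
  set q : Submodule K (ι → K) := S.map (coordVec j) with hq
  have hΦ : Function.Injective (extendZero (K := K) j) := fun Z Z' h => by
    ext ⟨i, hi⟩
    have h1 := congrFun h i
    rwa [extendZero_apply, extendZero_apply, dif_neg hi, dif_neg hi] at h1
  have he : Function.Injective (coordVec (K := K) j) := fun x y h => by
    have h1 := congrFun h j
    rwa [coordVec_apply, coordVec_apply, if_pos rfl, if_pos rfl] at h1
  -- the kernel is `p ⊔ q`
  have hker : LinearMap.ker (posForm ρ a c) = p ⊔ q := by
    refine le_antisymm (fun Y hY => ?_) (sup_le ?_ ?_)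
    · rw [LinearMap.mem_ker] at hY
      have hdec : Y = extendZero j (fun j' => Y j'.1) + coordVec j (Y j) := by
        ext i
        rw [Pi.add_apply, extendZero_apply, coordVec_apply]
        by_cases hi : i = j
        · rw [dif_pos hi, if_pos hi, hi, zero_add]
        · rw [dif_neg hi, if_neg hi, add_zero]
      obtain ⟨h0, ht⟩ := posForm_extendZero_add a c hidx (fun j' => Y j'.1) (Y j)
      rw [← hdec] at h0 ht
      rw [hdec]
      refine Submodule.add_mem_sup (Submodule.mem_map_of_mem ?_) (Submodule.mem_map_of_mem ?_)
      · rw [LinearMap.mem_ker]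
        ext t
        rw [← ht, hY, Pi.zero_apply, Pi.zero_apply]
      · rw [hS, LinearMap.mem_ker, LinearMap.smul_apply, LinearMap.id_apply, smul_eq_mul, ← h0, hY,
          Pi.zero_apply]
    · rintro _ ⟨Z, hZ, rfl⟩
      have hZ' : L' Z = 0 := LinearMap.mem_ker.mp hZ
      rw [LinearMap.mem_ker]
      obtain ⟨h0, ht⟩ := posForm_extendZero_add a c hidx Z 0
      rw [map_zero, add_zero] at h0 ht
      ext t
      by_cases htt : t = t₀
      · rw [htt, h0, mul_zero, Pi.zero_apply]
      · rw [show t = (⟨t, htt⟩ : {t : T // t ≠ t₀}).1 from rfl, ht, hZ', Pi.zero_apply, Pi.zero_apply]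
    · rintro _ ⟨x, hx, rfl⟩
      have hx' : κ₀ * x = 0 := by
        have h := LinearMap.mem_ker.mp hx
        rwa [LinearMap.smul_apply, LinearMap.id_apply, smul_eq_mul] at h
      rw [LinearMap.mem_ker]
      obtain ⟨h0, ht⟩ := posForm_extendZero_add a c hidx 0 x
      rw [map_zero, zero_add] at h0 ht
      ext t
      by_cases htt : t = t₀
      · rw [htt, h0, hx', Pi.zero_apply]
      · rw [show t = (⟨t, htt⟩ : {t : T // t ≠ t₀}).1 from rfl, ht, map_zero, Pi.zero_apply, Pi.zero_apply]
  -- `p` and `q` are disjoint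
  have hdisj : p ⊓ q = ⊥ := by
    rw [← disjoint_iff, Submodule.disjoint_def]
    rintro Y ⟨Z, -, rfl⟩ hYq
    obtain ⟨x, -, hx⟩ := hYq
    ext i
    by_cases hi : i = j
    · rw [hi, extendZero_apply, dif_pos rfl, Pi.zero_apply]
    · have h1 := congrFun hx i
      rw [coordVec_apply, if_neg hi] at h1
      rw [← h1, Pi.zero_apply]
  -- dimensions
  have hdim := Submodule.finrank_sup_add_finrank_inf_eq p q
  rw [hdisj, finrank_bot, add_zero] at hdim
  have hpdim : finrank K p = nullity (loopPos hidx) (fun j' : {j' : ι // j' ≠ j} => a j'.1)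
      (fun t : {t : T // t ≠ t₀} => c t.1) := by
    rw [hp, nullity, hL']
    exact (LinearEquiv.finrank_eq (Submodule.equivMapOfInjective _ hΦ _)).symm
  have hqdim : finrank K q = if wt a (ρ (Sum.inl t₀)) = c t₀ * wt a (ρ (Sum.inr t₀)) then 1 else 0 := by
    rw [hq, ← LinearEquiv.finrank_eq (Submodule.equivMapOfInjective _ he _), hS]
    split_ifs with h
    · rw [show κ₀ = 0 from sub_eq_zero.mpr h, zero_smul, LinearMap.ker_zero, finrank_top, Module.finrank_self]
    · rw [LinearMap.ker_smul _ _ (sub_ne_zero.mpr h), LinearMap.ker_id, finrank_bot]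
  rw [nullity, hker, hdim, hpdim, hqdim]

end NullitySteps


/-! ## The main theorem: induction on the number of pairs -/

section Main

universe u v

variable {ι : Type*}

/-- **Exact loop value** (Cor. 4's dichotomy `1 − d` / `1`, with the sign): for `A, B ≠ 0` with `A^d = B^d`,
`A·B·Σ_{l<d−1} A^l B^{d−2−l} = −A^d · (1 − d if A = B, else 1)`. [cite: Villaflor2022PeriodsCI, Corollary 4 (proof)] -/
theorem mul_mul_pairSum_eq [DecidableEq K] {d : ℕ} (hd : 2 ≤ d) {A B : K} (hAB : A ^ d = B ^ d) :
    A * B * pairSum (d - 1) A B = -A ^ d * if A = B then (1 - (d : K)) else 1 := by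
  split_ifs with h
  · subst h
    rw [pairSum_self, show d - 1 - 1 = d - 2 by omega, Nat.cast_sub (by omega : 1 ≤ d), Nat.cast_one]
    have hp : A * A * A ^ (d - 2) = A ^ d := by
      rw [← pow_two, ← pow_add, show 2 + (d - 2) = d by omega]
    linear_combination ((d : K) - 1) * hp
  · have h1 := pairSum_mul_sub (d - 1) A B
    have hsub : A - B ≠ 0 := sub_ne_zero.mpr h
    apply mul_right_cancel₀ hsub
    have h2 : A ^ (d - 1) * A = A ^ d := by rw [← pow_succ, Nat.sub_add_cancel (by omega : 1 ≤ d)]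
    have h3 : B ^ (d - 1) * B = B ^ d := by rw [← pow_succ, Nat.sub_add_cancel (by omega : 1 ≤ d)]
    linear_combination (A * B) * h1 + B * h2 - A * h3 + A * hAB

/-- Splitting a product over a finite type at one index. [folklore] -/
private theorem prod_eq_mul_prod_subtype_ne [Fintype ι] [DecidableEq ι] (f : ι → K) (i : ι) :
    ∏ j, f j = f i * ∏ j : {j : ι // j ≠ i}, f j.1 := by
  rw [← Finset.mul_prod_erase univ f (mem_univ i),
    Finset.prod_subtype (univ.erase i) (p := fun j => j ≠ i) (fun j => by simp)]

/-- The number of remaining pairs. [folklore] -/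
private theorem card_subtype_ne [Fintype ι] [DecidableEq ι] (i : ι) : Fintype.card {j : ι // j ≠ i} = Fintype.card ι - 1 := by
  rw [Fintype.card_subtype, Finset.filter_ne', Finset.card_erase_of_mem (mem_univ i), Finset.card_univ]

/-- Units `±1` of `ℤ` cast to `K`. [folklore] -/
private theorem cast_ite_units (P : Prop) [Decidable P] (x y : ℤˣ) :
    (((if P then x else y : ℤˣ) : ℤ) : K) = if P then ((x : ℤ) : K) else ((y : ℤ) : K) := by
  split_ifs <;> rfl

/-- **MAIN THEOREM (inductive form).** For two linear cycles of the Fermat variety of degree `d ≥ 2` in arbitrary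
mutual position `ρ` — twists `a_j^d = −1` (pairs `ι`, standard slots) and `c_t^d = −1` (pairs `T`, slots
`ρ(t,0), ρ(t,1)`) — the normalised period of the second over the first is
`(∏_j a_j)(∏_t c_t) · ℓ_a(P_c ∘ ρ) = sgnRel(ρ) · (1 − d)^{nullity}`, `nullity = dim(ℙ_a ∩ ℙ_{c,ρ}) + 1`.
Induction on the number of pairs: remove a pair `t₀` of the second cycle — a LOOP contributes
`−A^d·(1−d)^{[A = B]}` (`mul_mul_pairSum_eq`), a MERGE the sign `W₂^d` (`pairing_merge`), and the signs are
exactly the changes of `sgnRel` (`sgnRel_loopPos`, `sgnRel_mergePos`).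
[cite: AljovinMovasatiVillaflor2019, §3.1, eq. (4)] [cite: Villaflor2022PeriodsCI, Corollary 2 (ii), Corollary 4]
[cite: MovasatiVillaflor2018, Theorem 1] -/
theorem prod_mul_pairing_eq_aux [DecidableEq K] {d : ℕ} (hd : 2 ≤ d) :
    ∀ (n : ℕ) {ι : Type u} {T : Type v} [Fintype ι] [Fintype T] [DecidableEq ι] [DecidableEq T]
      (ρ : T ⊕ T ≃ ι ⊕ ι) (a : ι → K) (c : T → K), Fintype.card T = n →
      (∀ j, a j ^ d = -1) → (∀ t, c t ^ d = -1) →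
      ((∏ j, a j) * ∏ t, c t) * pairing d ρ a c = ((sgnRel ρ : ℤ) : K) * (1 - (d : K)) ^ nullity ρ a c := by
  intro n
  induction n with
  | zero =>
    intro ι T _ _ _ _ ρ a c hcard ha hc
    haveI : IsEmpty T := Fintype.card_eq_zero_iff.mp hcard
    haveI : IsEmpty ι := by
      have h := card_eq_of_pos ρ
      rw [hcard] at h
      exact Fintype.card_eq_zero_iff.mp h.symm
    have hsocle : fermatSocleExponent ι (d - 1) = 0 := by
      ext j
      exact isEmptyElim j
    have hpair : pairing d ρ a c = 1 := by
      rw [pairing, fermatLinearCycleFunctional_apply, fermatLinearCyclePolynomial, Fintype.prod_empty, map_one,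
        map_one, hsocle, coeff_zero_one]
    have hsgn : sgnRel ρ = 1 := by
      unfold sgnRel
      rw [show ρ.trans _ = (1 : Equiv.Perm (T ⊕ T)) from Equiv.ext fun x => isEmptyElim x,
        Equiv.Perm.sign_one]
    rw [hpair, hsgn, nullity_of_isEmpty, Fintype.prod_empty, Fintype.prod_empty]
    simp
  | succ n ih =>
    intro ι T _ _ _ _ ρ a c hcard ha hc
    have hd1 : 1 ≤ d := by omega
    obtain ⟨t₀⟩ : Nonempty T := Fintype.card_pos_iff.mp (by omega)
    have hcard' : Fintype.card {t : T // t ≠ t₀} = n := by rw [card_subtype_ne, hcard]; rfl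
    by_cases hidx : idx (ρ (Sum.inl t₀)) = idx (ρ (Sum.inr t₀))
    · /- LOOP -/
      have IH := ih (loopPos hidx) (fun j => a j.1) (fun t => c t.1) hcard' (fun j => ha j.1) (fun t => hc t.1)
      -- the value of the loop
      set A := wt a (ρ (Sum.inl t₀)) with hA
      set B := c t₀ * wt a (ρ (Sum.inr t₀)) with hB
      have hAd : A ^ d = if (ρ (Sum.inl t₀)).isLeft then -1 else 1 := wt_pow a ha _
      have hBd : B ^ d = if (ρ (Sum.inl t₀)).isLeft then -1 else 1 := by
        rw [hB, mul_pow, hc, eq_swap_of_loop hidx, wt_pow a ha]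
        rcases ρ (Sum.inl t₀) with j | j <;> simp
      have hval := mul_mul_pairSum_eq hd (hAd.trans hBd.symm)
      have hprodA : a (idx (ρ (Sum.inl t₀))) * c t₀ = A * B := by
        rw [hA, hB, ← wt_mul_wt_swap a (ρ (Sum.inl t₀)), ← eq_swap_of_loop hidx]
        ring
      -- signs
      have hs : ((sgnRel ρ : ℤ) : K) =
          (if (ρ (Sum.inl t₀)).isLeft then 1 else -1) * ((sgnRel (loopPos hidx) : ℤ) : K) := by
        rw [sgnRel_loopPos hidx, Units.val_mul, Int.cast_mul, cast_ite_units, ← mul_assoc]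
        split_ifs <;> simp
      have hneg : -A ^ d = if (ρ (Sum.inl t₀)).isLeft then 1 else -1 := by
        rw [hAd]; split_ifs <;> simp
      -- assemble
      rw [pairing_loop hd hidx, nullity_eq_nullity_loopPos_add a c hidx, pow_add, hs,
        prod_eq_mul_prod_subtype_ne a (idx (ρ (Sum.inl t₀))), prod_eq_mul_prod_subtype_ne c t₀]
      have e1 : a (idx (ρ (Sum.inl t₀))) * (∏ j : {j : ι // j ≠ idx (ρ (Sum.inl t₀))}, a j.1) *
          (c t₀ * ∏ t : {t : T // t ≠ t₀}, c t.1) *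
          (pairSum (d - 1) A B * pairing d (loopPos hidx) (fun j => a j.1) (fun t => c t.1)) =
          (A * B * pairSum (d - 1) A B) *
          (((∏ j : {j : ι // j ≠ idx (ρ (Sum.inl t₀))}, a j.1) * ∏ t : {t : T // t ≠ t₀}, c t.1) *
            pairing d (loopPos hidx) (fun j => a j.1) (fun t => c t.1)) := by
        rw [← hprodA]; ring
      rw [e1, IH, hval, hneg]
      split_ifs <;> ring
    · /- MERGE -/
      have IH := ih (mergePos hidx) (mergeTwist ρ a c t₀) (fun t => c t.1) hcard'
        (mergeTwist_pow hd1 ha hc) (fun t => hc t.1)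
      set W₁ := mergeW₁ ρ a c t₀ with hW₁def
      set W₂ := mergeW₂ ρ a t₀ with hW₂def
      have hW₁ : W₁ ≠ 0 := mergeW₁_ne_zero hd1 ha hc
      have hW₂ : W₂ ≠ 0 := mergeW₂_ne_zero hd1 ha
      have hne' : (⟨idx (ρ (Sum.inl t₀)), hidx⟩ : {j : ι // j ≠ idx (ρ (Sum.inr t₀))}) =
          ⟨idx (ρ (Sum.inl t₀)), hidx⟩ := rfl
      -- products
      have hPa : ∏ j, a j = a (idx (ρ (Sum.inr t₀))) * (a (idx (ρ (Sum.inl t₀))) *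
          ∏ j : {j' : {j : ι // j ≠ idx (ρ (Sum.inr t₀))} // j' ≠ ⟨idx (ρ (Sum.inl t₀)), hidx⟩}, a j.1.1) := by
        rw [prod_eq_mul_prod_subtype_ne a (idx (ρ (Sum.inr t₀))),
          prod_eq_mul_prod_subtype_ne (fun j : {j : ι // j ≠ idx (ρ (Sum.inr t₀))} => a j.1)
            ⟨idx (ρ (Sum.inl t₀)), hidx⟩]
      have hPa' : ∏ j, mergeTwist ρ a c t₀ j = W₁ / W₂ *
          ∏ j : {j' : {j : ι // j ≠ idx (ρ (Sum.inr t₀))} // j' ≠ ⟨idx (ρ (Sum.inl t₀)), hidx⟩}, a j.1.1 := by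
        rw [prod_eq_mul_prod_subtype_ne (mergeTwist ρ a c t₀) ⟨idx (ρ (Sum.inl t₀)), hidx⟩]
        congr 1
        · simp [mergeTwist, hW₁def, hW₂def]
        · refine Fintype.prod_congr _ _ fun j => ?_
          have hj : j.1.1 ≠ idx (ρ (Sum.inl t₀)) := fun h => j.2 (Subtype.ext h)
          simp [mergeTwist, hj]
      have hW : a (idx (ρ (Sum.inl t₀))) * a (idx (ρ (Sum.inr t₀))) * c t₀ = W₁ * W₂ := by
        rw [hW₁def, hW₂def, mergeW₁_mul_mergeW₂]; ring
      have hpow : W₂ ^ d = W₂ ^ (d - 2) * W₂ ^ 2 := by rw [← pow_add, Nat.sub_add_cancel hd]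
      -- signs
      have hε : W₂ ^ d * ((sgnRel (mergePos hidx) : ℤ) : K) = ((sgnRel ρ : ℤ) : K) := by
        rw [hW₂def, mergeW₂_pow ha, sgnRel_mergePos hidx, Units.val_mul, Units.val_mul, Int.cast_mul,
          Int.cast_mul, cast_ite_units, cast_ite_units]
        split_ifs <;> simp
      -- assemble
      rw [pairing_merge hd a c hidx ha hc, ← nullity_mergePos hd1 a c hidx ha hc, ← hε, hPa,
        prod_eq_mul_prod_subtype_ne c t₀]
      rw [hPa'] at IH
      have e1 : a (idx (ρ (Sum.inr t₀))) * (a (idx (ρ (Sum.inl t₀))) *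
          ∏ j : {j' : {j : ι // j ≠ idx (ρ (Sum.inr t₀))} // j' ≠ ⟨idx (ρ (Sum.inl t₀)), hidx⟩}, a j.1.1) *
          (c t₀ * ∏ t : {t : T // t ≠ t₀}, c t.1) *
          (W₂ ^ (d - 2) * pairing d (mergePos hidx) (mergeTwist ρ a c t₀) (fun t => c t.1)) =
          W₂ ^ d * ((W₁ / W₂ *
            ∏ j : {j' : {j : ι // j ≠ idx (ρ (Sum.inr t₀))} // j' ≠ ⟨idx (ρ (Sum.inl t₀)), hidx⟩}, a j.1.1) *
            (∏ t : {t : T // t ≠ t₀}, c t.1) *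
            pairing d (mergePos hidx) (mergeTwist ρ a c t₀) (fun t => c t.1)) := by
        have eL : a (idx (ρ (Sum.inr t₀))) * (a (idx (ρ (Sum.inl t₀))) *
            ∏ j : {j' : {j : ι // j ≠ idx (ρ (Sum.inr t₀))} // j' ≠ ⟨idx (ρ (Sum.inl t₀)), hidx⟩}, a j.1.1) *
            (c t₀ * ∏ t : {t : T // t ≠ t₀}, c t.1) *
            (W₂ ^ (d - 2) * pairing d (mergePos hidx) (mergeTwist ρ a c t₀) (fun t => c t.1)) =
            (a (idx (ρ (Sum.inl t₀))) * a (idx (ρ (Sum.inr t₀))) * c t₀) *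
            ((∏ j : {j' : {j : ι // j ≠ idx (ρ (Sum.inr t₀))} // j' ≠ ⟨idx (ρ (Sum.inl t₀)), hidx⟩}, a j.1.1) *
              (∏ t : {t : T // t ≠ t₀}, c t.1) * W₂ ^ (d - 2) *
              pairing d (mergePos hidx) (mergeTwist ρ a c t₀) (fun t => c t.1)) := by
          ring
        rw [eL, hW, hpow]
        field_simp
      rw [e1, IH, mul_assoc]

end Main


/-! ## The theorem and its corollaries -/

section Corollaries

variable {ι T : Type*} [Fintype ι] [Fintype T] [DecidableEq ι] [DecidableEq T]

/-- **THEOREM (intersection pairing of two linear cycles of the Fermat variety in arbitrary position — exact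
value).** Let `d ≥ 2`, let `ℙ_a = {x_{2j} = a_j x_{2j+1} (j ∈ ι)}` and `ℙ_{c,ρ} = {x_{ρ(t,0)} = c_t x_{ρ(t,1)} (t ∈ T)}`
be two linear cycles of `X^n_d = {Σ x_i^d = 0}` (`a_j^d = c_t^d = −1`, `ρ : T ⊕ T ≃ ι ⊕ ι` any re-pairing of the
`n + 2` coordinates). Then the period of (the normalised polynomial `(∏c)·P_c∘ρ` of) `ℙ_{c,ρ}` over `ℙ_a`, times
`∏ a_j`, is

  `(∏_j a_j)(∏_t c_t) · ℓ_a(P_c ∘ ρ) = sgnRel(ρ) · (1 − d)^{m+1}`,  `m + 1 = nullity ρ a c = dim(ℙ_a ∩ ℙ_{c,ρ}) + 1`.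

With the orientation signs of the cycle polynomials (`sgnRel`, MV18's `sign(b)·sign(b')`) this is the identity
`c·(d−1)^{n+2} = (1−d)^{m+1}` of Villaflor's Cor. 4 for ALL pairs of linear cycles, i.e. — through Cor. 2 (ii),
`δ·μ = deg δ deg μ/deg X − c (deg X − 1)^{n+2}/deg X` — the intersection numbers
`ℙ·ℙ' = (1 − (1−d)^{m+1})/d` of [AljovinMovasatiVillaflor2019] eq. (4) / [ho13].
[cite: AljovinMovasatiVillaflor2019, §3.1, eq. (4)] [cite: Villaflor2022PeriodsCI, Corollary 2 (ii), Corollary 4]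
[cite: MovasatiVillaflor2018, Theorem 1] -/
theorem prod_mul_pairing_eq {d : ℕ} (hd : 2 ≤ d) (ρ : T ⊕ T ≃ ι ⊕ ι) (a : ι → K) (c : T → K)
    (ha : ∀ j, a j ^ d = -1) (hc : ∀ t, c t ^ d = -1) :
    ((∏ j, a j) * ∏ t, c t) *
        fermatLinearCycleFunctional a (d - 1) (rename ρ (fermatLinearCyclePolynomial c (d - 1))) =
      ((sgnRel ρ : ℤ) : K) * (1 - (d : K)) ^ nullity ρ a c := by
  classical
  exact prod_mul_pairing_eq_aux hd (Fintype.card T) ρ a c rfl ha hc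

/-- The same with the exponent written as the dimension of the cone over `ℙ_a ∩ ℙ_{c,ρ}` in `K^{n+2}`
(`= dim(ℙ_a ∩ ℙ_{c,ρ}) + 1`, the kernel of the `n + 2` linear forms of both cycles).
[cite: AljovinMovasatiVillaflor2019, §3.1, eq. (4)] -/
theorem prod_mul_pairing_eq_finrank {d : ℕ} (hd : 2 ≤ d) (ρ : T ⊕ T ≃ ι ⊕ ι) (a : ι → K) (c : T → K)
    (ha : ∀ j, a j ^ d = -1) (hc : ∀ t, c t ^ d = -1) :
    ((∏ j, a j) * ∏ t, c t) *
        fermatLinearCycleFunctional a (d - 1) (rename ρ (fermatLinearCyclePolynomial c (d - 1))) =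
      ((sgnRel ρ : ℤ) : K) * (1 - (d : K)) ^ finrank K (LinearMap.ker (jointForm ρ a c)) := by
  rw [finrank_ker_jointForm]
  exact prod_mul_pairing_eq hd ρ a c ha hc

/-- Both cycles indexed by the same set of pairs: the sign is the sign of the permutation `ρ` of the slots.
[cite: MovasatiVillaflor2018, Theorem 1] [cite: AljovinMovasatiVillaflor2019, §3.1, eq. (4)] -/
theorem prod_mul_pairing_eq_sign {d : ℕ} (hd : 2 ≤ d) (ρ : Equiv.Perm (ι ⊕ ι)) (a c : ι → K)
    (ha : ∀ j, a j ^ d = -1) (hc : ∀ t, c t ^ d = -1) :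
    ((∏ j, a j) * ∏ t, c t) *
        fermatLinearCycleFunctional a (d - 1) (rename ρ (fermatLinearCyclePolynomial c (d - 1))) =
      ((Equiv.Perm.sign ρ : ℤ) : K) * (1 - (d : K)) ^ nullity ρ a c := by
  rw [← sgnRel_eq_sign]
  exact prod_mul_pairing_eq hd ρ a c ha hc

/-- The pairing never vanishes (`d ≥ 2`, characteristic not dividing `d − 1`… in fact over any field in which
`1 − d ≠ 0`): two linear cycles of the Fermat variety are never orthogonal for the period pairing.
[cite: AljovinMovasatiVillaflor2019, §3.1, eq. (4)] -/
theorem pairing_ne_zero {d : ℕ} (hd : 2 ≤ d) (hK : (1 - (d : K)) ≠ 0) (ρ : T ⊕ T ≃ ι ⊕ ι) (a : ι → K)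
    (c : T → K) (ha : ∀ j, a j ^ d = -1) (hc : ∀ t, c t ^ d = -1) :
    fermatLinearCycleFunctional a (d - 1) (rename ρ (fermatLinearCyclePolynomial c (d - 1))) ≠ 0 := by
  intro h
  have h' := prod_mul_pairing_eq hd ρ a c ha hc
  rw [h, mul_zero] at h'
  have hs : ((sgnRel ρ : ℤ) : K) ≠ 0 := by
    rcases Int.units_eq_one_or (sgnRel ρ) with h1 | h1 <;> simp [h1]
  exact mul_ne_zero hs (pow_ne_zero _ hK) h'.symm

/-! ### In the vocabulary of [MovasatiVillaflor2018]: `ℙ_{a,b}` against `ℙ_{a',b'}` -/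

open MovasatiVillaflor2018

variable {n : ℕ}

/-- **The joint linear system of `ℙ_{a,b}` and `ℙ_{a',b'}`** in the coordinates `x_0, …, x_{n+1}`:
`x_{b(2e)} − ζ^{1+2a_{2e+1}} x_{b(2e+1)}` and `x_{b'(2e)} − ζ^{1+2a'_{2e+1}} x_{b'(2e+1)}`, `e = 0..n/2`
(`jointFormMV_apply_inl/inr`); its kernel is the cone over `ℙ_{a,b} ∩ ℙ_{a',b'}`.
[cite: MovasatiVillaflor2018, §1] [cite: AljovinMovasatiVillaflor2019, §3.1, eq. (4)] -/
def jointFormMV (n : ℕ) (ζ : K) (a a' : Fin (n + 2) → ℕ) (b b' : Equiv.Perm (Fin (n + 2))) (hn : Even n) :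
    (Fin (n + 2) → K) →ₗ[K] (Fin (n / 2 + 1) ⊕ Fin (n / 2 + 1) → K) :=
  (jointForm (((pairEquiv n hn).trans b').trans ((pairEquiv n hn).trans b).symm) (twist n ζ a) (twist n ζ a')).comp
    (LinearEquiv.funCongrLeft K K ((pairEquiv n hn).trans b)).toLinearMap

/-- First block: the equations of `ℙ_{a,b}`. [cite: MovasatiVillaflor2018, §1] -/
theorem jointFormMV_apply_inl (ζ : K) (a a' : Fin (n + 2) → ℕ) (b b' : Equiv.Perm (Fin (n + 2))) (hn : Even n)
    (x : Fin (n + 2) → K) (e : Fin (n / 2 + 1)) :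
    jointFormMV n ζ a a' b b' hn x (Sum.inl e) = x (b ⟨2 * e, by omega⟩) - twist n ζ a e * x (b ⟨2 * e + 1, by omega⟩) := by
  simp [jointFormMV, jointForm, LinearMap.funLeft_apply]

/-- Second block: the equations of `ℙ_{a',b'}`. [cite: MovasatiVillaflor2018, §1] -/
theorem jointFormMV_apply_inr (ζ : K) (a a' : Fin (n + 2) → ℕ) (b b' : Equiv.Perm (Fin (n + 2))) (hn : Even n)
    (x : Fin (n + 2) → K) (e : Fin (n / 2 + 1)) :
    jointFormMV n ζ a a' b b' hn x (Sum.inr e) =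
      x (b' ⟨2 * e, by omega⟩) - twist n ζ a' e * x (b' ⟨2 * e + 1, by omega⟩) := by
  simp [jointFormMV, jointForm, LinearMap.funLeft_apply]

/-- `dim ker` of the joint system in the coordinates `x_i` is the nullity of the abstract configuration.
[cite: AljovinMovasatiVillaflor2019, §3.1, eq. (4)] -/
theorem finrank_ker_jointFormMV (ζ : K) (a a' : Fin (n + 2) → ℕ) (b b' : Equiv.Perm (Fin (n + 2))) (hn : Even n) :
    finrank K (LinearMap.ker (jointFormMV n ζ a a' b b' hn)) =
      nullity (((pairEquiv n hn).trans b').trans ((pairEquiv n hn).trans b).symm) (twist n ζ a) (twist n ζ a') := by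
  rw [← finrank_ker_jointForm, jointFormMV, LinearMap.ker_comp, Submodule.comap_equiv_eq_map_symm,
    LinearEquiv.finrank_map_eq]

/-- The twists `ζ^{1+2a_{2e+1}}` are `d`-th roots of `−1` when `ζ^d = −1`. [cite: MovasatiVillaflor2018, §1] -/
theorem twist_pow_eq_neg_one {d : ℕ} {ζ : K} (hζ : ζ ^ d = -1) (a : Fin (n + 2) → ℕ) (e : Fin (n / 2 + 1)) :
    twist n ζ a e ^ d = -1 := by
  rw [twist, ← pow_mul, mul_comm, pow_mul, hζ]
  exact Odd.neg_one_pow ⟨a ⟨2 * e + 1, by omega⟩, by ring⟩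

/-- **THEOREM (MV18 form).** For `ζ^d = −1`, `d ≥ 2`, `n` even and ANY `a, a', b, b'`: the MV18 period functional
of `ℙ^{n/2}_{a,b}` (tree `linearCycleFunctional`, carrying `sign(b)·ζ^{Σ(1+2a_{2e+1})}`) evaluated on Villaflor's
normalised polynomial `P_δ/c_δ` of `ℙ^{n/2}_{a',b'}` (tree `linearCyclePolyMV`) is

  `ℓ_{a,b}(P^{MV}_{a',b'}) = sign(b') · (1 − d)^{dim(ℙ_{a,b} ∩ ℙ_{a',b'}) + 1}`,

equivalently `ℓ_{a,b}(sign(b')·P^{MV}_{a',b'}) = (1 − d)^{m+1}` is SIGN-FREE: the algebraic shadow of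
`[ℙ]_prim·[ℙ']_prim = −(1−d)^{m+1}/d`, i.e. of `ℙ_i·ℙ_j = (1 − (1−d)^{m+1})/d` for ALL pairs of linear cycles.
[cite: AljovinMovasatiVillaflor2019, §3.1, eq. (4)] [cite: MovasatiVillaflor2018, Theorem 1]
[cite: Villaflor2022PeriodsCI, Corollary 2 (ii), Corollary 4] [cite: Villaflorloyola2021, Proposition 5.2] -/
theorem linearCycleFunctional_linearCyclePolyMV {d : ℕ} (hn : Even n) (hd : 2 ≤ d) {ζ : K} (hζ : ζ ^ d = -1)
    (a a' : Fin (n + 2) → ℕ) (b b' : Equiv.Perm (Fin (n + 2))) :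
    linearCycleFunctional n d ζ a b hn (linearCyclePolyMV n d ζ a' b' hn) =
      ((Equiv.Perm.sign b' : ℤ) : K) * (1 - (d : K)) ^ finrank K (LinearMap.ker (jointFormMV n ζ a a' b b' hn)) := by
  set θ := (pairEquiv n hn).trans b with hθ
  set θ' := (pairEquiv n hn).trans b' with hθ'
  have main := prod_mul_pairing_eq hd (θ'.trans θ.symm) (twist n ζ a) (twist n ζ a')
    (twist_pow_eq_neg_one hζ a) (twist_pow_eq_neg_one hζ a')
  have hζprod : ζ ^ (∑ e : Fin (n / 2 + 1), (1 + 2 * a ⟨2 * e + 1, by omega⟩)) = ∏ e, twist n ζ a e := by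
    rw [← Finset.prod_pow_eq_pow_sum]
    rfl
  have hsgn : sgnRel (θ'.trans θ.symm) = Equiv.Perm.sign b * Equiv.Perm.sign b' := by
    rw [sgnRel_eq_sign, show θ'.trans θ.symm =
      (pairEquiv n hn).trans ((b'.trans b.symm).trans (pairEquiv n hn).symm) from
        Equiv.ext fun x => by simp [hθ, hθ'],
      Equiv.Perm.sign_trans_trans, Equiv.Perm.sign_trans, Equiv.Perm.sign_symm, Equiv.self_trans_symm,
      Equiv.Perm.sign_refl, mul_one]
  have hbb : ((Equiv.Perm.sign b : ℤ) : K) * ((Equiv.Perm.sign b : ℤ) : K) = 1 := by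
    rw [← Int.cast_mul, ← Units.val_mul, Int.units_mul_self, Units.val_one, Int.cast_one]
  rw [finrank_ker_jointFormMV, linearCycleFunctional, linearCyclePolyMV, linearCyclePoly, LinearMap.smul_apply,
    LinearMap.comp_apply, AlgHom.toLinearMap_apply, map_mul, rename_C, rename_rename, ← Equiv.coe_trans,
    fermatLinearCycleFunctional_apply, map_mul, fermatLinearCycleSubst_C, coeff_C_mul,
    ← fermatLinearCycleFunctional_apply, smul_eq_mul, hζprod, ← hθ, ← hθ']
  rw [hsgn, Units.val_mul, Int.cast_mul] at main
  calc ((Equiv.Perm.sign b : ℤ) : K) * (∏ e, twist n ζ a e) * ((∏ e, twist n ζ a' e) *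
        fermatLinearCycleFunctional (twist n ζ a) (d - 1)
          (rename (θ'.trans θ.symm) (fermatLinearCyclePolynomial (twist n ζ a') (d - 1))))
      = ((Equiv.Perm.sign b : ℤ) : K) * (((∏ e, twist n ζ a e) * ∏ e, twist n ζ a' e) *
        fermatLinearCycleFunctional (twist n ζ a) (d - 1)
          (rename (θ'.trans θ.symm) (fermatLinearCyclePolynomial (twist n ζ a') (d - 1)))) := by ring
    _ = ((Equiv.Perm.sign b' : ℤ) : K) * (1 - (d : K)) ^
        nullity (θ'.trans θ.symm) (twist n ζ a) (twist n ζ a') := by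
      rw [main]
      linear_combination (((Equiv.Perm.sign b' : ℤ) : K) * (1 - (d : K)) ^
        nullity (θ'.trans θ.symm) (twist n ζ a) (twist n ζ a')) * hbb

/-- **Sign-free form**: `ℓ_{a,b}(sign(b')·P^{MV}_{a',b'}) = (1 − d)^{dim(ℙ_{a,b} ∩ ℙ_{a',b'}) + 1}`.
[cite: AljovinMovasatiVillaflor2019, §3.1, eq. (4)] [cite: MovasatiVillaflor2018, Theorem 1] -/
theorem linearCycleFunctional_sign_smul_linearCyclePolyMV {d : ℕ} (hn : Even n) (hd : 2 ≤ d) {ζ : K}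
    (hζ : ζ ^ d = -1) (a a' : Fin (n + 2) → ℕ) (b b' : Equiv.Perm (Fin (n + 2))) :
    linearCycleFunctional n d ζ a b hn ((((Equiv.Perm.sign b' : ℤ) : K)) • linearCyclePolyMV n d ζ a' b' hn) =
      (1 - (d : K)) ^ finrank K (LinearMap.ker (jointFormMV n ζ a a' b b' hn)) := by
  have hbb : ((Equiv.Perm.sign b' : ℤ) : K) * ((Equiv.Perm.sign b' : ℤ) : K) = 1 := by
    rw [← Int.cast_mul, ← Units.val_mul, Int.units_mul_self, Units.val_one, Int.cast_one]
  rw [LinearMap.map_smul, linearCycleFunctional_linearCyclePolyMV hn hd hζ, smul_eq_mul, ← mul_assoc, hbb, one_mul]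

end Corollaries


/-! ## The socle form: `ℓ_c(g)` is the socle coefficient of `g · P_c` (Villaflor's `P·P_δ ≡ c·det Hess F`) -/

section SocleForm

variable {τ : Type*} [Fintype τ]

omit [Fintype τ] in
/-- `x_{2j+1}^{e−1}·P_{λ_j} ≡ x_{2j}^{e−1}x_{2j+1}^{e−1} (mod J)`: only the term `l = e − 1` of the factor survives.
[cite: Villaflor2022PeriodsCI, Corollary 4 (proof)] -/
private theorem X_pow_mul_factor_sub_mem (c : τ → K) {e : ℕ} (he : 1 ≤ e) (j : τ) :
    (X (Sum.inr j) : MvPolynomial (τ ⊕ τ) K) ^ (e - 1) * fermatLinearCycleFactor c e j -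
        X (Sum.inl j) ^ (e - 1) * X (Sum.inr j) ^ (e - 1) ∈
      Ideal.span (Set.range fun i : τ ⊕ τ => (X i : MvPolynomial (τ ⊕ τ) K) ^ e) := by
  rw [fermatLinearCycleFactor, Finset.mul_sum, show Finset.range e = Finset.range (e - 1 + 1) by
    rw [Nat.sub_add_cancel he], Finset.sum_range_succ, Nat.sub_self, pow_zero, mul_one, mul_comm _ (X _ ^ _),
    add_sub_cancel_right]
  refine Ideal.sum_mem _ fun l hl => ?_
  rw [Finset.mem_range] at hl
  have hfac : (X (Sum.inr j) : MvPolynomial (τ ⊕ τ) K) ^ (e - 1) *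
      (X (Sum.inl j) ^ l * (C (c j) * X (Sum.inr j)) ^ (e - 1 - l)) =
      (X (Sum.inl j) ^ l * C (c j ^ (e - 1 - l)) * X (Sum.inr j) ^ (e - 2 - l)) * X (Sum.inr j) ^ e := by
    rw [mul_pow, ← map_pow, show e - 1 = (e - 2 - l) + (l + 1) by omega, pow_add,
      show e - 2 - l + (l + 1) - l = e - 1 - l by omega]
    have : (X (Sum.inr j) : MvPolynomial (τ ⊕ τ) K) ^ (l + 1) * X (Sum.inr j) ^ (e - 1 - l) =
        X (Sum.inr j) ^ e := by
      rw [← pow_add, show l + 1 + (e - 1 - l) = e by omega]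
    linear_combination (X (Sum.inl j) ^ l * C (c j ^ (e - 1 - l)) * X (Sum.inr j) ^ (e - 2 - l)) * this
  rw [hfac]
  exact Ideal.mul_mem_left _ _ (Ideal.subset_span ⟨Sum.inr j, rfl⟩)

/-- `(∏_j x_{2j+1}^{e−1})·P_c ≡ x^{socle} (mod J)`. [cite: Villaflor2022PeriodsCI, Corollary 4 (proof)] -/
private theorem prod_X_pow_mul_sub_monomial_mem (c : τ → K) {e : ℕ} (he : 1 ≤ e) :
    (∏ j, (X (Sum.inr j) : MvPolynomial (τ ⊕ τ) K) ^ (e - 1)) * fermatLinearCyclePolynomial c e -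
        monomial (fermatSocleExponent (τ ⊕ τ) e) 1 ∈
      Ideal.span (Set.range fun i : τ ⊕ τ => (X i : MvPolynomial (τ ⊕ τ) K) ^ e) := by
  rw [← Ideal.Quotient.eq, fermatLinearCyclePolynomial, ← Finset.prod_mul_distrib, map_prod,
    ← prod_X_pow_eq_monomial_fermatSocleExponent, Fintype.prod_sum_type, ← Finset.prod_mul_distrib, map_prod]
  refine Finset.prod_congr rfl fun j _ => ?_
  rw [Ideal.Quotient.eq]
  exact X_pow_mul_factor_sub_mem c he j

/-- **`ℓ_c(g) = coeff_{x^{socle}}(g · P_c)`**: the restriction-to-the-cycle functional of DFV Rem. 7.1 (tree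
`fermatLinearCycleFunctional`, whose values are MV18's periods) IS the socle pairing with the cycle polynomial
`P_c = ∏_j Σ_l x_{2j}^l (c_j x_{2j+1})^{e−1−l}` — the number `c` of Villaflor's `P·P_δ ≡ c·det(Hess F) (mod J^F)`
(Cor. 2 (ii), Remark 5; `det Hess = d^{n+2}(d−1)^{n+2}∏x_i^{d−2}` at Fermat) with NO further constant. Both
functionals have annihilator `(J : P_c)` (Gorenstein duality, tree `colon_C_mul_fermatLinearCyclePolynomial_eq_annIdeal`),
hence are proportional (Macaulay), and both take the value `1` on `∏_j x_{2j+1}^{e−1}`.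
[cite: Villaflor2022PeriodsCI, Corollary 2 (ii), Corollary 4] [cite: DuqueFrancoVillaflor2025Join, Remark 7.1]
[cite: IarrobinoKanev1999, Lemma 2.12] -/
theorem fermatSocleFunctional_mul_fermatLinearCyclePolynomial (c : τ → K) {e : ℕ} (he : 1 ≤ e)
    (g : MvPolynomial (τ ⊕ τ) K) :
    fermatSocleFunctional K (τ ⊕ τ) e (g * fermatLinearCyclePolynomial c e) = fermatLinearCycleFunctional c e g := by
  classical
  set ψ := fermatSocleFunctional K (τ ⊕ τ) e ∘ₗ LinearMap.mulRight K (C 1 * fermatLinearCyclePolynomial c e)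
    with hψ
  have hann : annIdeal ψ = annIdeal (fermatLinearCycleFunctional c e) := by
    rw [hψ, ← span_X_pow_colon_eq_annIdeal he, colon_C_mul_fermatLinearCyclePolynomial_eq_annIdeal e he one_ne_zero c]
  obtain ⟨κ, -, hκeq⟩ := (annIdeal_eq_annIdeal_iff_exists_smul
    (socleFunctional_comp_mulRight_homogeneousComponent e 1 c) (fermatLinearCycleFunctional_homogeneousComponent c e)
    (fermatLinearCycleFunctional_ne_zero c e)).mp hann
  -- both functionals take the value 1 on `g₀ = ∏_j x_{2j+1}^{e−1}`
  set g₀ : MvPolynomial (τ ⊕ τ) K := rename Sum.inr (monomial (fermatSocleExponent τ e) 1) with hg₀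
  have hℓ : fermatLinearCycleFunctional c e g₀ = 1 := by
    rw [hg₀, fermatLinearCycleFunctional_apply, fermatLinearCycleSubst_rename_inr, coeff_monomial, if_pos rfl]
  have hg₀' : g₀ = ∏ j, (X (Sum.inr j) : MvPolynomial (τ ⊕ τ) K) ^ (e - 1) := by
    rw [hg₀, ← prod_X_pow_eq_monomial_fermatSocleExponent, map_prod]
    simp only [map_pow, rename_X]
  have hψ0 : ψ g₀ = 1 := by
    rw [hψ, LinearMap.comp_apply, LinearMap.mulRight_apply, C_1, one_mul, hg₀']
    have h := fermatSocleFunctional_eq_zero_of_mem (K := K) he (prod_X_pow_mul_sub_monomial_mem c he)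
    rw [map_sub, sub_eq_zero] at h
    rw [h, fermatSocleFunctional_apply, coeff_monomial, if_pos rfl]
  have hκ1 : κ = 1 := by
    have h := LinearMap.congr_fun hκeq g₀
    rw [LinearMap.smul_apply, hℓ, hψ0, smul_eq_mul, mul_one] at h
    exact h.symm
  have h := LinearMap.congr_fun hκeq g
  rw [hκ1, one_smul] at h
  rw [h, LinearMap.comp_apply, LinearMap.mulRight_apply, C_1, one_mul]

/-- **THE EXACT COLON IDEAL OF A SUM OF TWO LINEAR CYCLES** (no undetermined rescaling): for `J = (x_i^e)`,
`e ≥ 1`, any scalars `a₁, a₂` and twist vectors `t₁, t₂`,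
`(J : a₁P_{t₁} + a₂P_{t₂}) = Ann(a₁ℓ_{t₁} + a₂ℓ_{t₂})` — sharpening the tree's
`Villaflor2022.exists_colon_add_eq_annIdeal` ("`= Ann(ℓ_{t₁} + w ℓ_{t₂})` for SOME `w ≠ 0`"): the Artinian
Gorenstein ideal `J^{F, r[ℙ]+ř[ℙ̌]}` of the census rows is the annihilator of the SAME combination of the period
functionals. [cite: Villaflor2022PeriodsCI, Remark 7, Corollary 4] [cite: DuqueFrancoVillaflor2025Join, Remark 2.1] -/
theorem colon_add_eq_annIdeal_add (c₁ c₂ : τ → K) {e : ℕ} (he : 1 ≤ e) (a₁ a₂ : K) :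
    (Ideal.span (Set.range fun i : τ ⊕ τ => (X i : MvPolynomial (τ ⊕ τ) K) ^ e)).colon
        {C a₁ * fermatLinearCyclePolynomial c₁ e + C a₂ * fermatLinearCyclePolynomial c₂ e} =
      annIdeal (a₁ • fermatLinearCycleFunctional c₁ e + a₂ • fermatLinearCycleFunctional c₂ e) := by
  rw [span_X_pow_colon_eq_annIdeal he]
  congr 1
  refine LinearMap.ext fun g => ?_
  simp only [LinearMap.coe_comp, Function.comp_apply, LinearMap.mulRight_apply, LinearMap.add_apply,
    LinearMap.smul_apply, smul_eq_mul, mul_add, map_add]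
  rw [← mul_assoc, mul_comm g (C a₁), mul_assoc, ← mul_assoc g, mul_comm g (C a₂), mul_assoc,
    ← smul_eq_C_mul, ← smul_eq_C_mul, LinearMap.map_smul, LinearMap.map_smul, smul_eq_mul, smul_eq_mul,
    fermatSocleFunctional_mul_fermatLinearCyclePolynomial c₁ he, fermatSocleFunctional_mul_fermatLinearCyclePolynomial c₂ he]

variable {ι T : Type*} [Fintype ι] [Fintype T] [DecidableEq ι] [DecidableEq T]

/-- **Socle form of the main theorem** (Villaflor's normalisation): the socle coefficient of the product of the
two cycle polynomials is `coeff_{x^{socle}}(P_a · P_c∘ρ) = sgnRel(ρ)·(1−d)^{m+1}/((∏a)(∏c))`, i.e. with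
`P_δ = d^{n/2+1}(∏a)P_a`, `P_μ = sign·d^{n/2+1}(∏c)P_c∘ρ` and `det Hess(Σx_i^d) = d^{n+2}(d−1)^{n+2}∏x_i^{d−2}`:
`c·(d−1)^{n+2} = (1−d)^{m+1}` for EVERY pair of linear cycles. [cite: Villaflor2022PeriodsCI, Corollary 2 (ii), Corollary 4]
[cite: AljovinMovasatiVillaflor2019, §3.1, eq. (4)] -/
theorem prod_mul_fermatSocleFunctional_mul_eq {d : ℕ} (hd : 2 ≤ d) (ρ : T ⊕ T ≃ ι ⊕ ι) (a : ι → K) (c : T → K)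
    (ha : ∀ j, a j ^ d = -1) (hc : ∀ t, c t ^ d = -1) :
    ((∏ j, a j) * ∏ t, c t) * fermatSocleFunctional K (ι ⊕ ι) (d - 1)
        (rename ρ (fermatLinearCyclePolynomial c (d - 1)) * fermatLinearCyclePolynomial a (d - 1)) =
      ((sgnRel ρ : ℤ) : K) * (1 - (d : K)) ^ nullity ρ a c := by
  rw [fermatSocleFunctional_mul_fermatLinearCyclePolynomial a (by omega)]
  exact prod_mul_pairing_eq hd ρ a c ha hc

end SocleForm


/-! ## Consistency: the same pairing (Villaflor Cor. 4 as printed) -/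

section SamePairing

variable {ι : Type*} [Fintype ι]

/-- For the SAME pairing (`ρ = 1`) the restricted equations are diagonal, `(a_t − c_t)·y_t`, so the nullity is the
number of agreeing twists `#{t : a_t = c_t}` (`= m + 1`, `m = dim ℙ_α ∩ ℙ_β`: each agreeing pair is a common
hyperplane, each disagreeing pair forces two coordinates to vanish). [cite: Villaflor2022PeriodsCI, Corollary 4] -/
theorem nullity_refl [DecidableEq K] (a c : ι → K) :
    nullity (Equiv.refl (ι ⊕ ι)) a c = Fintype.card {t : ι // a t = c t} := by
  rw [nullity, ← Module.finrank_fintype_fun_eq_card (R := K)]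
  refine LinearEquiv.finrank_eq ?_
  have hker : ∀ Y : ι → K, Y ∈ LinearMap.ker (posForm (Equiv.refl (ι ⊕ ι)) a c) ↔ ∀ t, a t ≠ c t → Y t = 0 := by
    intro Y
    rw [LinearMap.mem_ker, funext_iff]
    refine forall_congr' fun t => ?_
    rw [posForm_apply, Pi.zero_apply, Equiv.refl_apply, Equiv.refl_apply, wt_inl, wt_inr, idx_inl, idx_inr,
      mul_one, ← sub_mul, mul_eq_zero, sub_eq_zero]
    tauto
  exact
    { toFun := fun Y t => Y.1 t.1
      map_add' := fun Y Z => rfl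
      map_smul' := fun r Y => rfl
      invFun := fun Z => ⟨fun t => if h : a t = c t then Z ⟨t, h⟩ else 0, (hker _).mpr fun t ht => dif_neg ht⟩
      left_inv := fun Y => by
        ext t
        simp only
        split_ifs with h
        · rfl
        · exact ((hker Y.1).mp Y.2 t h).symm
      right_inv := fun Z => by
        ext ⟨t, ht⟩
        simp only [dif_pos ht] }

/-- **The printed same-pairing case recovered**: `(∏a)(∏c)·ℓ_a(P_c) = (1 − d)^{#{t : a_t = c_t}}` (Villaflor Cor. 4:
`c(d−1)^{n+2} = (1−d)^{m+1}`; the tree's `DuqueFrancoVillaflor2023.prod_mul_fermatLinearCycleFunctional_eq` by a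
different route). [cite: Villaflor2022PeriodsCI, Corollary 4] -/
theorem prod_mul_fermatLinearCycleFunctional_eq_pow_card [DecidableEq ι] [DecidableEq K] {d : ℕ} (hd : 2 ≤ d)
    (a c : ι → K) (ha : ∀ j, a j ^ d = -1) (hc : ∀ t, c t ^ d = -1) :
    ((∏ j, a j) * ∏ t, c t) * fermatLinearCycleFunctional a (d - 1) (fermatLinearCyclePolynomial c (d - 1)) =
      (1 - (d : K)) ^ Fintype.card {t : ι // a t = c t} := by
  have h := prod_mul_pairing_eq_sign hd (Equiv.refl (ι ⊕ ι)) a c ha hc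
  rwa [Equiv.coe_refl, rename_id, AlgHom.id_apply, Equiv.Perm.sign_refl, Units.val_one, Int.cast_one, one_mul,
    nullity_refl] at h

end SamePairing


/-! ## Symmetry of the pairing -/

section Symmetry

variable {ι T : Type*} [Fintype ι] [Fintype T]

omit [Fintype ι] [Fintype T] in
/-- The socle functional is invariant under any bijective relabelling of the coordinates (the socle exponent
`(e−1, …, e−1)` is symmetric). [cite: IarrobinoKanev1999, Example 5.8] -/
theorem fermatSocleFunctional_rename_equiv [Finite ι] [Finite T] (σ : (ι ⊕ ι) ≃ (T ⊕ T)) (e : ℕ)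
    (g : MvPolynomial (ι ⊕ ι) K) :
    fermatSocleFunctional K (T ⊕ T) e (rename σ g) = fermatSocleFunctional K (ι ⊕ ι) e g := by
  have hmap : Finsupp.mapDomain σ (fermatSocleExponent (ι ⊕ ι) e) = fermatSocleExponent (T ⊕ T) e := by
    ext y
    obtain ⟨x, rfl⟩ := σ.surjective y
    rw [Finsupp.mapDomain_apply σ.injective, fermatSocleExponent_apply, fermatSocleExponent_apply]
  rw [fermatSocleFunctional_apply, fermatSocleFunctional_apply, ← hmap, coeff_rename_mapDomain _ σ.injective]

/-- **Symmetry of the intersection pairing**: `ℓ_a(P_c ∘ ρ) = ℓ_c(P_a ∘ ρ⁻¹)` — the period of `ℙ_{c,ρ}` over `ℙ_a`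
equals the period of `ℙ_a` (placed by `ρ⁻¹`) over `ℙ_c`; with `ψ = ℓ` both are the socle coefficient of the
product of the two cycle polynomials (`δ·μ = μ·δ`). [cite: Villaflor2022PeriodsCI, Corollary 2 (ii)]
[cite: AljovinMovasatiVillaflor2019, §3.1, eq. (4)] -/
theorem pairing_symm {d : ℕ} (hd : 2 ≤ d) (ρ : T ⊕ T ≃ ι ⊕ ι) (a : ι → K) (c : T → K) :
    fermatLinearCycleFunctional a (d - 1) (rename ρ (fermatLinearCyclePolynomial c (d - 1))) =
      fermatLinearCycleFunctional c (d - 1) (rename ρ.symm (fermatLinearCyclePolynomial a (d - 1))) := by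
  rw [← fermatSocleFunctional_mul_fermatLinearCyclePolynomial a (by omega),
    ← fermatSocleFunctional_mul_fermatLinearCyclePolynomial c (by omega),
    ← fermatSocleFunctional_rename_equiv ρ.symm (d - 1), map_mul, rename_rename, mul_comm]
  congr 2
  rw [show (ρ.symm ∘ ρ : T ⊕ T → T ⊕ T) = id from funext fun x => ρ.symm_apply_apply x, rename_id,
    AlgHom.id_apply]

end Symmetry


/-! ## The second cycle in arbitrary position: socle form and the exact Gorenstein ideal -/

section ArbitraryPosition

variable {ι T : Type*} [Fintype ι] [Fintype T]

/-- `coeff_{x^{socle}}(g · (P_c ∘ ρ)) = ℓ_c(g ∘ ρ⁻¹)`: the socle pairing with the cycle polynomial of `ℙ_{c,ρ}`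
(second cycle in ARBITRARY position) is the period functional of that cycle. [cite: Villaflor2022PeriodsCI, Corollary 2 (ii)]
[cite: DuqueFrancoVillaflor2025Join, Remark 7.1] -/
theorem fermatSocleFunctional_mul_rename_fermatLinearCyclePolynomial (ρ : T ⊕ T ≃ ι ⊕ ι) (c : T → K) {e : ℕ}
    (he : 1 ≤ e) (g : MvPolynomial (ι ⊕ ι) K) :
    fermatSocleFunctional K (ι ⊕ ι) e (g * rename ρ (fermatLinearCyclePolynomial c e)) =
      fermatLinearCycleFunctional c e (rename ρ.symm g) := by
  rw [← fermatSocleFunctional_rename_equiv ρ.symm e, map_mul, rename_rename,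
    show (ρ.symm ∘ ρ : T ⊕ T → T ⊕ T) = id from funext fun x => ρ.symm_apply_apply x, rename_id, AlgHom.id_apply,
    fermatSocleFunctional_mul_fermatLinearCyclePolynomial c he]

/-- **THE EXACT ARTINIAN GORENSTEIN IDEAL OF `a₁[ℙ_{c₁}] + a₂[ℙ_{c₂,ρ}]`, second cycle in ARBITRARY position**:
`(J : a₁P_{c₁} + a₂·(P_{c₂} ∘ ρ)) = Ann(a₁ℓ_{c₁} + a₂·(ℓ_{c₂} ∘ ρ⁻¹))` — Villaflor's `J^{F,λ}` of a two-cycle class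
is the annihilator of the SAME combination of the two period functionals, with no undetermined constant.
[cite: Villaflor2022PeriodsCI, Remark 7, Corollary 4] [cite: Villaflorloyola2021, Definition 2.1]
[cite: DuqueFrancoVillaflor2025Join, Remark 2.1] -/
theorem colon_add_rename_eq_annIdeal (ρ : T ⊕ T ≃ ι ⊕ ι) (c₁ : ι → K) (c₂ : T → K) {e : ℕ} (he : 1 ≤ e)
    (a₁ a₂ : K) :
    (Ideal.span (Set.range fun i : ι ⊕ ι => (X i : MvPolynomial (ι ⊕ ι) K) ^ e)).colon
        {C a₁ * fermatLinearCyclePolynomial c₁ e + C a₂ * rename ρ (fermatLinearCyclePolynomial c₂ e)} =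
      annIdeal (a₁ • fermatLinearCycleFunctional c₁ e +
        a₂ • (fermatLinearCycleFunctional c₂ e ∘ₗ
          (rename ρ.symm : MvPolynomial (ι ⊕ ι) K →ₐ[K] MvPolynomial (T ⊕ T) K).toLinearMap)) := by
  rw [span_X_pow_colon_eq_annIdeal he]
  congr 1
  refine LinearMap.ext fun g => ?_
  simp only [LinearMap.coe_comp, Function.comp_apply, LinearMap.mulRight_apply, LinearMap.add_apply,
    LinearMap.smul_apply, smul_eq_mul, mul_add, map_add, AlgHom.toLinearMap_apply]
  rw [← mul_assoc, mul_comm g (C a₁), mul_assoc, ← mul_assoc g, mul_comm g (C a₂), mul_assoc,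
    ← smul_eq_C_mul, ← smul_eq_C_mul, LinearMap.map_smul, LinearMap.map_smul, smul_eq_mul, smul_eq_mul,
    fermatSocleFunctional_mul_fermatLinearCyclePolynomial c₁ he,
    fermatSocleFunctional_mul_rename_fermatLinearCyclePolynomial ρ c₂ he]

end ArbitraryPosition


/-! ## The intersection number of two linear cycles [cite: AljovinMovasatiVillaflor2019, §3.1 eq. (4)] -/

section IntersectionNumber

/-- The intersection number `ℙ · ℙ' = (1 - (-d+1)^{m+1})/d` of two linear cycles of the degree-`d` Fermat variety
`X^n_d` meeting in a linear space `ℙ ∩ ℙ'` of dimension `m`, as printed, written as a function of `d` and of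
`k = m + 1` — the dimension of the intersection of the affine cones, i.e. `nullity ρ a c`
(`= finrank ker (jointFormMV …)`) in the notation of this file. It is an integer: `d ∣ 1 - (1-d)^k`.
[cite: AljovinMovasatiVillaflor2019, §3.1 eq. (4)] [cite: Villaflor2022PeriodsCI, Corollary 4] -/
def linearCyclesIntersectionNumber (d k : ℕ) : ℤ := (1 - (1 - (d : ℤ)) ^ k) / d

/-- `d ∣ 1 - (1-d)^k`. [folklore] -/
private theorem natCast_dvd_one_sub_one_sub_pow (d k : ℕ) : (d : ℤ) ∣ 1 - (1 - (d : ℤ)) ^ k := by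
  have h := sub_dvd_pow_sub_pow (1 : ℤ) (1 - d) k
  rwa [one_pow, sub_sub_cancel] at h

/-- `d · (ℙ · ℙ') = 1 - (1-d)^{m+1}`: the division in eq. (4) is exact.
[cite: AljovinMovasatiVillaflor2019, §3.1 eq. (4)] [cite: Villaflor2022PeriodsCI, Corollary 4] -/
theorem natCast_mul_linearCyclesIntersectionNumber (d k : ℕ) :
    (d : ℤ) * linearCyclesIntersectionNumber d k = 1 - (1 - (d : ℤ)) ^ k :=
  Int.mul_ediv_cancel' (natCast_dvd_one_sub_one_sub_pow d k)

/-- Disjoint linear cycles (`m = -1`, i.e. `k = 0`) have intersection number `0`.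
[cite: AljovinMovasatiVillaflor2019, §3.1 eq. (4)] [cite: MovasatiVillaflor2018, Theorem 2] -/
@[simp] theorem linearCyclesIntersectionNumber_zero (d : ℕ) : linearCyclesIntersectionNumber d 0 = 0 := by
  simp [linearCyclesIntersectionNumber]

/-- `ℙ · ℙ' = (1-d)·(intersection number one dimension lower) + 1`: the recursion behind eq. (4)
(`k = 1`: two linear cycles meeting in a point meet transversally, `ℙ · ℙ' = 1`; `k = 2, d = 3, n = 2`: a line on
a smooth cubic surface has self-intersection `2 - 3 = -1`). [cite: AljovinMovasatiVillaflor2019, §3.1 eq. (4)] -/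
theorem linearCyclesIntersectionNumber_succ {d : ℕ} (hd : d ≠ 0) (k : ℕ) :
    linearCyclesIntersectionNumber d (k + 1) = (1 - d) * linearCyclesIntersectionNumber d k + 1 := by
  have hd' : (d : ℤ) ≠ 0 := by exact_mod_cast hd
  apply mul_left_cancel₀ hd'
  rw [mul_add, mul_left_comm, natCast_mul_linearCyclesIntersectionNumber,
    natCast_mul_linearCyclesIntersectionNumber]
  ring

/-- Two linear cycles meeting in exactly one point (`m = 0`) have intersection number `1` (`P_i · ℙ^{n/2} = 1`,
transversal intersection). [cite: AljovinMovasatiVillaflor2019, §3.1] -/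
theorem linearCyclesIntersectionNumber_one {d : ℕ} (hd : d ≠ 0) : linearCyclesIntersectionNumber d 1 = 1 := by
  rw [linearCyclesIntersectionNumber_succ hd, linearCyclesIntersectionNumber_zero, mul_zero, zero_add]

variable {ι T : Type*} [Fintype ι] [Fintype T] [DecidableEq ι] [DecidableEq T]

/-- **Villaflor's Corollary 2 (ii) solved for the socle constant, with the printed intersection number**:
`(∏a)(∏c) · ℓ_a(P_{c,ρ}) = sgnRel(ρ) · (1 - d · (ℙ_a · ℙ_{c,ρ}))`, where `ℙ_a · ℙ_{c,ρ} = (1 - (1-d)^{m+1})/d` is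
the intersection number of eq. (4) (`δ·μ = deg δ·deg μ/deg X - c·(deg X - 1)^{n+2}/deg X` with `deg δ = deg μ = 1`,
i.e. `c·(d-1)^{n+2} = 1 - d·(δ·μ)`). [cite: Villaflor2022PeriodsCI, Corollary 2 (ii), Corollary 4]
[cite: AljovinMovasatiVillaflor2019, §3.1 eq. (4)] [cite: MovasatiVillaflor2018, Theorem 1] -/
theorem prod_mul_pairing_eq_intersectionNumber {d : ℕ} (hd : 2 ≤ d) (ρ : T ⊕ T ≃ ι ⊕ ι) (a : ι → K) (c : T → K)
    (ha : ∀ j, a j ^ d = -1) (hc : ∀ t, c t ^ d = -1) :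
    ((∏ j, a j) * ∏ t, c t) * fermatLinearCycleFunctional a (d - 1) (rename ρ (fermatLinearCyclePolynomial c (d - 1))) =
      ((sgnRel ρ : ℤ) : K) * (1 - (d : K) * (linearCyclesIntersectionNumber d (nullity ρ a c) : K)) := by
  rw [prod_mul_pairing_eq hd ρ a c ha hc]
  congr 1
  have h := congrArg (Int.cast : ℤ → K) (natCast_mul_linearCyclesIntersectionNumber d (nullity ρ a c))
  push_cast at h
  rw [h, sub_sub_cancel]

end IntersectionNumber

end Literature.AlgebraicGeometry.AljovinMovasatiVillaflor2019

end
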